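import Literature.MathematicalPhysics.StatisticalMechanics.HardDiscVirialRingProofs
import HarnessLib

/-!
# The fourth virial coefficient of hard discs: `B₄/B₂³ = 2 − 9√3/(2π) + 10/π²`
(the complete star diagram `V(K₄) = π³ − (3√3/2)π² + π`, and the discharge of
`ClisbyMcCoy2004_B4_hardDiscs`; Rowlinson 1964 / Hemmer 1964 as printed in Clisby–McCoy 2004 §1)

Third file of the hard-disc virial computations, after `HardDiscVirialProofs.lean` (`B₃`) and
`HardDiscVirialRingProofs.lean` (ring `V(C₄) = π³ − 16π/3` and diamond `V(◇) = π³ − √3π² − 5π/6`).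
It computes the complete star `V(K₄) = vol{(r₂, r₃, r₄) ∈ (ℝ²)³ | all six distances among
0, r₂, r₃, r₄ are < 1}` and assembles
`B₄/B₂³ = (−(3/8)V(C₄) + (3/4)V(◇) − (1/8)V(K₄))/(π/2)³ = 2 − 9√3/(2π) + 10/π² ≈ 0.53223`
(`ClisbyMcCoy2004_B4_hardDiscs_holds`).

## The argument for `V(K₄)` (symmetry and scaling instead of Rowlinson's direct integration of
the triple-intersection area)

Coordinates `x = (r₂, (r₃, r₄)) ∈ (ℝ × ℝ) × (ℝ × ℝ) × (ℝ × ℝ)`; the six squared bond lengths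
`bond 0 … 5 = |r₂|², |r₃|², |r₄|², |r₂−r₃|², |r₂−r₄|², |r₃−r₄|²` (local notation).

1. **Argmax decomposition** (`volume_star_eq_six_mul`): up to the null ties
   (`volume_tie_eq_zero`: their `r₃`- or `r₄`-sections are circles) the star set is the disjoint
   union of the six strict pieces `P i = {bond i < 1, bond j < bond i (j ≠ i)}`, which have equal
   volumes: explicit volume-preserving relabellings of the four points permute the bonds
   transitively (`exists_bond_symmetry`; the re-rooting `(r₂, r₃, r₄) ↦ (r₂ − r₃, r₂, r₂ − r₄)`
   is a skew product of the reflections `t ↦ r₂ − t` with a coordinate transposition).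
   Hence `V(K₄) = 6 · vol(P 0)`.
2. **Scaling** (`volume_slice_P0`, `volume_P0`): the `r₂`-slice of `P 0` at `p ≠ 0` is the
   preimage of the standard set `Std = {(y, z) | |y|, |z|, |y − e|, |z − e|, |y − z| < 1}`,
   `e = (1, 0)`, under complex division by `p` on both factors (a linear map of `(ℝ²)²` of
   determinant `|p|⁻⁴`), so `vol(P 0) = vol Std · ∫_{|p|<1} |p|⁴ dp = (π/3) vol Std` and
   `V(K₄) = 2π · vol Std` (`volume_starProd`).
3. `Std = (L × L) ∖ Far` with `L = D(0) ∩ D(e)` the unit-distance lens, of area `2π/3 − √3/2`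
   (`volume_unitLens`), and `Far = {(y, z) ∈ L × L | |y − z| ≥ 1}` (`volume_std_eq`).
4. **Slicing `Far` by abscissae** (`volume_far2_eq_lintegral`): after the measure-preserving
   shuffle `((u,v),(u',v')) ↦ ((u,u'),(v,v'))` the `(u, u')`-section of `Far` is
   `{|v| < m(u), |v'| < m(u'), |v − v'| ≥ c}`, `m(u)² = 1 − max(u², (1−u)²)`, `c² = 1 − (u − u')²`;
   since `c ≥ m(u), m(u')` it consists of two corner triangles of total area
   `(m(u) + m(u') − c)₊²` (`volume_section_far`). Hence `vol Far = Ψ` with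
   `Ψ = ∫∫_{(0,1)²} (m(u) + m(u') − c)₊² du du'`.
5. **`Ψ = 1/4 − π²/18 + √3π/12`** (`integral_sq_posPart`): on `Ω = {c ≤ m + m'}` write
   `(m + m' − c)² = R₁ + R₂` with `R₁ = 2m² + c² + 2mm' − 4mc` and `R₂` antisymmetric under
   `(u, u') ↦ (u', u)` (`sq_posPart_eq`, `setIntegral_sq_eq_zero_of_swap`; this removes the
   non-elementary term `m(u')c`); Fubini; the symmetry `u ↦ 1 − u` halves the outer range; the
   substitution `u = 1 − cos A`, `A ∈ (0, π/3)` (`integral_image_eq_integral_abs_deriv_smul`); on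
   that line `Ω = {u' ≥ 1 − cos(π/3 − A)}` (`omega_iff`) and the inner integral is elementary
   (`inner_integral_R1t`: primitives of `√(1 − x²)`); the addition formulas turn
   `sin A · (inner integral)` into a polynomial `Tpoly` in `A, sin A, cos A` (`sin_mul_kA`, a
   certified polynomial identity modulo `sin² + cos² = 1`, `(√3)² = 3`) with an explicit
   antiderivative (`hasDerivAt_psiPrim`).
6. `V(K₄) = 2π((2π/3 − √3/2)² − Ψ) = π³ − (3√3/2)π² + π` (`volume_far_value`,
   `volume_starProd_toReal`); transfer to `Fin 6 → ℝ` (`measurePreserving_toFin6`,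
   `measurePreserving_toFin6'`: product Lebesgue measures agree on boxes, `Measure.pi_eq`), whence
   `volume_hardDiscRing_toReal`, `volume_hardDiscDiamond_toReal`, `volume_hardDiscStar_toReal`
   and the discharge.

Everything is elementary ([folklore]) except the final discharge, which carries the cite; no
definitions and no named facts are introduced (sub-namespace `HardDiscB4Volume`, local notations
only). The exact values were cross-checked numerically (quadrature and Monte Carlo) beforehand.

## References

* [ClisbyMccoy2004] N. Clisby, B. M. McCoy, *Analytic calculation of B₄ for hard spheres in even
  dimensions*, J. Stat. Phys. 114 (2004) 1343–1361, §1 (display `B₄/B₂³` for `D = 2` and the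
  Mayer expansion of `B₄`, citing J. S. Rowlinson, *The virial expansion in two dimensions*,
  Mol. Phys. 7 (1964) 593–594, and P. C. Hemmer, *Virial coefficients for the hard-core gas in
  two dimensions*, J. Chem. Phys. 42 (1964) 1116–1118), §2 (definition of the complete star
  integral).
-/

noncomputable section

open MeasureTheory Set Real Filter
open scoped ENNReal

namespace Literature.MathematicalPhysics.StatisticalMechanics

namespace HardDiscB4Volume
/-! ## The complete star: reduction by bond symmetry and scaling

Coordinates `x = (r₂, (r₃, r₄)) : (ℝ × ℝ) × (ℝ × ℝ) × (ℝ × ℝ)`; the six squared bond lengths of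
the rooted configuration `(0, r₂, r₃, r₄)` are `bond 0 … bond 5 =
|r₂|², |r₃|², |r₄|², |r₂−r₃|², |r₂−r₄|², |r₃−r₄|²`. -/

section Star

/-- Configuration space of the three free points. -/
local notation "X6" => (ℝ × ℝ) × (ℝ × ℝ) × (ℝ × ℝ)

-- The six squared bond lengths, as a `Fin 6`-indexed family of functions (local notation `bond`).
set_option quotPrecheck false in
local notation "bond" => (![fun x : (ℝ × ℝ) × (ℝ × ℝ) × (ℝ × ℝ) => x.1.1 ^ 2 + x.1.2 ^ 2,
    fun x : (ℝ × ℝ) × (ℝ × ℝ) × (ℝ × ℝ) => x.2.1.1 ^ 2 + x.2.1.2 ^ 2,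
    fun x : (ℝ × ℝ) × (ℝ × ℝ) × (ℝ × ℝ) => x.2.2.1 ^ 2 + x.2.2.2 ^ 2,
    fun x : (ℝ × ℝ) × (ℝ × ℝ) × (ℝ × ℝ) => (x.1.1 - x.2.1.1) ^ 2 + (x.1.2 - x.2.1.2) ^ 2,
    fun x : (ℝ × ℝ) × (ℝ × ℝ) × (ℝ × ℝ) => (x.1.1 - x.2.2.1) ^ 2 + (x.1.2 - x.2.2.2) ^ 2,
    fun x : (ℝ × ℝ) × (ℝ × ℝ) × (ℝ × ℝ) => (x.2.1.1 - x.2.2.1) ^ 2 + (x.2.1.2 - x.2.2.2) ^ 2] :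
    Fin 6 → (ℝ × ℝ) × (ℝ × ℝ) × (ℝ × ℝ) → ℝ)

/-- Each bond function is measurable. [folklore] -/
theorem measurable_bond (i : Fin 6) : Measurable (bond i) := by
  fin_cases i <;> simp <;> fun_prop

/-- The "weak argmax" pieces `W i = {bond i < 1, all bonds ≤ bond i}` are measurable. [folklore] -/
theorem measurableSet_W (i : Fin 6) :
    MeasurableSet {x : X6 | bond i x < 1 ∧ ∀ j, bond j x ≤ bond i x} := by
  simp only [setOf_and, setOf_forall]
  refine (measurableSet_lt (measurable_bond i) measurable_const).inter
    (MeasurableSet.iInter fun j => measurableSet_le (measurable_bond j) (measurable_bond i))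

/-- The "strict argmax" pieces `P i = {bond i < 1, other bonds < bond i}` are measurable.
[folklore] -/
theorem measurableSet_P (i : Fin 6) :
    MeasurableSet {x : X6 | bond i x < 1 ∧ ∀ j, j ≠ i → bond j x < bond i x} := by
  simp only [setOf_and, setOf_forall]
  exact (measurableSet_lt (measurable_bond i) measurable_const).inter
    (MeasurableSet.iInter fun j => MeasurableSet.iInter fun _ =>
      measurableSet_lt (measurable_bond j) (measurable_bond i))

/-- **Bond symmetry.** For every bond `i` there is a volume-preserving map `g` of the
configuration space (a relabelling of the four points `0, r₂, r₃, r₄`, re-rooted at the new first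
point and composed with a point reflection) under which the bonds are permuted with
`bond 0 ∘ g = bond i`. [folklore] -/
theorem exists_bond_symmetry (i : Fin 6) :
    ∃ g : X6 → X6, MeasurePreserving g volume volume ∧ ∃ σ : Fin 6 ≃ Fin 6, σ 0 = i ∧
      ∀ j x, bond j (g x) = bond (σ j) x := by
  -- the transposition of `r₂` and `r₃`
  have h1 : MeasurePreserving (fun x : X6 => (x.2.1, (x.1, x.2.2))) volume volume := by
    have e := ((volume_preserving_prodAssoc (α₁ := ℝ × ℝ) (β₁ := ℝ × ℝ) (γ₁ := ℝ × ℝ)).comp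
      (((Measure.measurePreserving_swap (μ := (volume : Measure (ℝ × ℝ)))
        (ν := (volume : Measure (ℝ × ℝ)))).prod (MeasurePreserving.id
          (volume : Measure (ℝ × ℝ)))).comp
        ((volume_preserving_prodAssoc (α₁ := ℝ × ℝ) (β₁ := ℝ × ℝ) (γ₁ := ℝ × ℝ)).symm _)))
    exact e
  -- the transposition of `r₃` and `r₄`
  have h2 : MeasurePreserving (fun x : X6 => (x.1, (x.2.2, x.2.1))) volume volume := by
    have e := (MeasurePreserving.id (volume : Measure (ℝ × ℝ))).prod
      (Measure.measurePreserving_swap (μ := (volume : Measure (ℝ × ℝ)))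
        (ν := (volume : Measure (ℝ × ℝ))))
    exact e
  -- re-rooting at `r₂` composed with the point reflection: `(r₂, r₃, r₄) ↦ (r₂−r₃, r₂, r₂−r₄)`
  have h3 : MeasurePreserving (fun x : X6 => (x.1 - x.2.1, (x.1, x.1 - x.2.2))) volume volume := by
    have hsk : MeasurePreserving (fun x : X6 => (x.1, (x.1 - x.2.1, x.1 - x.2.2)))
        volume volume := by
      have hfib : ∀ a : ℝ × ℝ, MeasurePreserving
          (Prod.map (fun t : ℝ × ℝ => a - t) (fun t : ℝ × ℝ => a - t))
          ((volume : Measure (ℝ × ℝ)).prod volume) ((volume : Measure (ℝ × ℝ)).prod volume) :=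
        fun a => (Measure.measurePreserving_sub_left volume a).prod
          (Measure.measurePreserving_sub_left volume a)
      have hmeas : Measurable (Function.uncurry
          fun (a : ℝ × ℝ) (q : (ℝ × ℝ) × (ℝ × ℝ)) => (a - q.1, a - q.2)) :=
        Measurable.prodMk (measurable_fst.sub measurable_snd.fst)
          (measurable_fst.sub measurable_snd.snd)
      have e := (MeasurePreserving.id (volume : Measure (ℝ × ℝ))).skew_product
        (g := fun (a : ℝ × ℝ) (q : (ℝ × ℝ) × (ℝ × ℝ)) => (a - q.1, a - q.2))
        hmeas (ae_of_all _ fun a => (hfib a).map_eq)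
      exact e
    have e := h1.comp hsk
    exact e
  fin_cases i
  · refine ⟨id, MeasurePreserving.id _, Equiv.refl _, rfl, fun j x => rfl⟩
  · refine ⟨_, h1, ⟨![1, 0, 2, 3, 5, 4], ![1, 0, 2, 3, 5, 4], by decide, by decide⟩, by decide, ?_⟩
    intro j x
    fin_cases j
    all_goals simp
    all_goals ring
  · refine ⟨_, (h2.comp h1).comp h2, ⟨![2, 1, 0, 5, 4, 3], ![2, 1, 0, 5, 4, 3], by decide,
      by decide⟩, by decide, ?_⟩
    intro j x
    fin_cases j
    all_goals simp
    all_goals ring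
  · refine ⟨_, h3, ⟨![3, 0, 4, 1, 5, 2], ![1, 3, 5, 0, 2, 4], by decide, by decide⟩, by decide, ?_⟩
    intro j x
    fin_cases j
    all_goals simp
    all_goals ring
  · refine ⟨_, h3.comp h2, ⟨![4, 0, 3, 2, 5, 1], ![1, 5, 3, 2, 0, 4], by decide, by decide⟩,
      by decide, ?_⟩
    intro j x
    fin_cases j
    all_goals simp
  · refine ⟨_, h3.comp (h2.comp h1), ⟨![5, 1, 3, 2, 4, 0], ![5, 1, 3, 2, 4, 0], by decide,
      by decide⟩, by decide, ?_⟩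
    intro j x
    fin_cases j
    all_goals simp
    all_goals ring

/-- The weak pieces all have the volume of `W 0`. [folklore] -/
theorem volume_W_eq (i : Fin 6) :
    volume {x : X6 | bond i x < 1 ∧ ∀ j, bond j x ≤ bond i x} =
      volume {x : X6 | bond 0 x < 1 ∧ ∀ j, bond j x ≤ bond 0 x} := by
  obtain ⟨g, hg, σ, hσ0, hσ⟩ := exists_bond_symmetry i
  have hpre : g ⁻¹' {x : X6 | bond 0 x < 1 ∧ ∀ j, bond j x ≤ bond 0 x} =
      {x : X6 | bond i x < 1 ∧ ∀ j, bond j x ≤ bond i x} := by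
    ext x
    rw [mem_preimage, mem_setOf_eq, mem_setOf_eq]
    constructor
    · rintro ⟨h1, h2⟩
      refine ⟨?_, fun j => ?_⟩
      · rw [hσ, hσ0] at h1; exact h1
      · have := h2 (σ.symm j); rw [hσ, hσ, hσ0, Equiv.apply_symm_apply] at this; exact this
    · rintro ⟨h1, h2⟩
      refine ⟨?_, fun j => ?_⟩
      · rw [hσ, hσ0]; exact h1
      · rw [hσ, hσ, hσ0]; exact h2 (σ j)
  rw [← hpre, hg.measure_preimage (measurableSet_W 0).nullMeasurableSet]

/-- The strict pieces all have the volume of `P 0`. [folklore] -/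
theorem volume_P_eq (i : Fin 6) :
    volume {x : X6 | bond i x < 1 ∧ ∀ j, j ≠ i → bond j x < bond i x} =
      volume {x : X6 | bond 0 x < 1 ∧ ∀ j, j ≠ 0 → bond j x < bond 0 x} := by
  obtain ⟨g, hg, σ, hσ0, hσ⟩ := exists_bond_symmetry i
  have hpre : g ⁻¹' {x : X6 | bond 0 x < 1 ∧ ∀ j, j ≠ 0 → bond j x < bond 0 x} =
      {x : X6 | bond i x < 1 ∧ ∀ j, j ≠ i → bond j x < bond i x} := by
    ext x
    rw [mem_preimage, mem_setOf_eq, mem_setOf_eq]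
    constructor
    · rintro ⟨h1, h2⟩
      refine ⟨?_, fun j hj => ?_⟩
      · rw [hσ, hσ0] at h1; exact h1
      · have := h2 (σ.symm j) (fun h' => hj (by rw [← Equiv.apply_symm_apply σ j, h', hσ0]))
        rw [hσ, hσ, hσ0, Equiv.apply_symm_apply] at this; exact this
    · rintro ⟨h1, h2⟩
      refine ⟨?_, fun j hj => ?_⟩
      · rw [hσ, hσ0]; exact h1
      · rw [hσ, hσ, hσ0]; exact h2 (σ j) (fun h' => hj (σ.injective (h'.trans hσ0.symm)))
  rw [← hpre, hg.measure_preimage (measurableSet_P 0).nullMeasurableSet]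


/-! ### Ties are null; the star set is six copies of `P 0` up to null sets -/

/-- A measurable subset of the configuration space all of whose `r₃`-sections are null is null.
[folklore] -/
theorem null_of_null_sections_r3 {T : Set X6} (hT : MeasurableSet T)
    (h : ∀ a c : ℝ × ℝ, volume {q : ℝ × ℝ | (a, (q, c)) ∈ T} = 0) : volume T = 0 := by
  rw [Measure.volume_eq_prod]
  refine prod_null_of_sections hT fun a => ?_
  rw [Measure.volume_eq_prod]
  exact prod_null_of_sections_symm (measurable_prodMk_left hT) fun c => h a c

/-- A measurable subset of the configuration space all of whose `r₄`-sections are null is null.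
[folklore] -/
theorem null_of_null_sections_r4 {T : Set X6} (hT : MeasurableSet T)
    (h : ∀ a b : ℝ × ℝ, volume {q : ℝ × ℝ | (a, (b, q)) ∈ T} = 0) : volume T = 0 := by
  rw [Measure.volume_eq_prod]
  refine prod_null_of_sections hT fun a => ?_
  rw [Measure.volume_eq_prod]
  exact prod_null_of_sections (measurable_prodMk_left hT) fun b => h a b

/-- The tie sets `{bond j = bond 0}`, `j ≠ 0`, are null (their `r₃`- or `r₄`-sections are
circles). [folklore] -/
theorem volume_tie_eq_zero (j : Fin 6) (hj : j ≠ 0) :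
    volume {x : X6 | bond j x = bond 0 x} = 0 := by
  have hT : MeasurableSet {x : X6 | bond j x = bond 0 x} :=
    measurableSet_eq_fun (measurable_bond j) (measurable_bond 0)
  fin_cases j
  · exact absurd rfl hj
  · refine null_of_null_sections_r3 hT fun a c => ?_
    refine measure_mono_null (fun q hq => ?_) (volume_circle_eq_zero 0 0 (a.1 ^ 2 + a.2 ^ 2))
    simp only [mem_setOf_eq] at hq ⊢
    simp at hq
    linear_combination hq
  · refine null_of_null_sections_r4 hT fun a b => ?_
    refine measure_mono_null (fun q hq => ?_) (volume_circle_eq_zero 0 0 (a.1 ^ 2 + a.2 ^ 2))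
    simp only [mem_setOf_eq] at hq ⊢
    simp at hq
    linear_combination hq
  · refine null_of_null_sections_r3 hT fun a c => ?_
    refine measure_mono_null (fun q hq => ?_) (volume_circle_eq_zero a.1 a.2 (a.1 ^ 2 + a.2 ^ 2))
    simp only [mem_setOf_eq] at hq ⊢
    simp at hq
    linear_combination hq
  · refine null_of_null_sections_r4 hT fun a b => ?_
    refine measure_mono_null (fun q hq => ?_) (volume_circle_eq_zero a.1 a.2 (a.1 ^ 2 + a.2 ^ 2))
    simp only [mem_setOf_eq] at hq ⊢
    simp at hq
    linear_combination hq
  · refine null_of_null_sections_r3 hT fun a c => ?_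
    refine measure_mono_null (fun q hq => ?_) (volume_circle_eq_zero c.1 c.2 (a.1 ^ 2 + a.2 ^ 2))
    simp only [mem_setOf_eq] at hq ⊢
    simp at hq
    linear_combination hq

/-- `W 0 \ P 0` is null (it lies in the ties). [folklore] -/
theorem volume_W0_diff_P0 :
    volume ({x : X6 | bond 0 x < 1 ∧ ∀ j, bond j x ≤ bond 0 x} \
      {x : X6 | bond 0 x < 1 ∧ ∀ j, j ≠ 0 → bond j x < bond 0 x}) = 0 := by
  refine measure_mono_null (t := ⋃ j : Fin 6, {x : X6 | j ≠ 0 ∧ bond j x = bond 0 x}) ?_ ?_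
  · rintro x ⟨⟨h1, h2⟩, h3⟩
    simp only [mem_setOf_eq, not_and, not_forall, not_lt] at h3
    obtain ⟨j, hj, hle⟩ := h3 h1
    exact mem_iUnion.2 ⟨j, hj, le_antisymm (h2 j) hle⟩
  · refine measure_iUnion_null_iff.2 fun j => ?_
    by_cases hj : j = 0
    · subst hj; simp
    · exact measure_mono_null (fun x hx => hx.2) (volume_tie_eq_zero j hj)

/-- The star set `{all bonds < 1}` is covered by the weak pieces. [folklore] -/
theorem star_subset_iUnion_W :
    {x : X6 | ∀ i, bond i x < 1} ⊆ ⋃ i, {x : X6 | bond i x < 1 ∧ ∀ j, bond j x ≤ bond i x} := by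
  intro x hx
  obtain ⟨i, -, hi⟩ := Finset.exists_max_image Finset.univ (fun i => bond i x)
    Finset.univ_nonempty
  exact mem_iUnion.2 ⟨i, hx i, fun j => hi j (Finset.mem_univ j)⟩

/-- The strict pieces lie in the star set. [folklore] -/
theorem P_subset_star (i : Fin 6) :
    {x : X6 | bond i x < 1 ∧ ∀ j, j ≠ i → bond j x < bond i x} ⊆ {x : X6 | ∀ i, bond i x < 1} := by
  rintro x ⟨h1, h2⟩ j
  by_cases h : j = i
  · rw [h]; exact h1
  · exact (h2 j h).trans h1

/-- The strict pieces are pairwise disjoint. [folklore] -/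
theorem pairwise_disjoint_P : Pairwise (Function.onFun Disjoint fun i : Fin 6 =>
    {x : X6 | bond i x < 1 ∧ ∀ j, j ≠ i → bond j x < bond i x}) := by
  intro i i' hii'
  refine disjoint_left.2 fun x hx hx' => ?_
  exact lt_irrefl _ ((hx.2 i' hii'.symm).trans (hx'.2 i hii'))

/-- **Argmax decomposition.** `vol {all bonds < 1} = 6 · vol (P 0)`. [folklore] -/
theorem volume_star_eq_six_mul :
    volume {x : X6 | ∀ i, bond i x < 1} =
      6 * volume {x : X6 | bond 0 x < 1 ∧ ∀ j, j ≠ 0 → bond j x < bond 0 x} := by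
  apply le_antisymm
  · calc volume {x : X6 | ∀ i, bond i x < 1}
        ≤ volume (⋃ i, {x : X6 | bond i x < 1 ∧ ∀ j, bond j x ≤ bond i x}) :=
          measure_mono star_subset_iUnion_W
      _ ≤ ∑' i, volume {x : X6 | bond i x < 1 ∧ ∀ j, bond j x ≤ bond i x} :=
          measure_iUnion_le _
      _ = ∑ i : Fin 6, volume {x : X6 | bond 0 x < 1 ∧ ∀ j, bond j x ≤ bond 0 x} := by
          rw [tsum_fintype]; exact Finset.sum_congr rfl fun i _ => volume_W_eq i
      _ ≤ ∑ _i : Fin 6, volume {x : X6 | bond 0 x < 1 ∧ ∀ j, j ≠ 0 → bond j x < bond 0 x} := by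
          refine Finset.sum_le_sum fun i _ => ?_
          calc volume {x : X6 | bond 0 x < 1 ∧ ∀ j, bond j x ≤ bond 0 x}
              ≤ volume ({x : X6 | bond 0 x < 1 ∧ ∀ j, j ≠ 0 → bond j x < bond 0 x} ∪
                  ({x : X6 | bond 0 x < 1 ∧ ∀ j, bond j x ≤ bond 0 x} \
                    {x : X6 | bond 0 x < 1 ∧ ∀ j, j ≠ 0 → bond j x < bond 0 x})) :=
                measure_mono (fun x hx => by
                  by_cases h : x ∈ {x : X6 | bond 0 x < 1 ∧ ∀ j, j ≠ 0 → bond j x < bond 0 x}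
                  · exact Or.inl h
                  · exact Or.inr ⟨hx, h⟩)
            _ ≤ _ + _ := measure_union_le _ _
            _ = _ := by rw [volume_W0_diff_P0, add_zero]
      _ = 6 * volume {x : X6 | bond 0 x < 1 ∧ ∀ j, j ≠ 0 → bond j x < bond 0 x} := by
          rw [Finset.sum_const, Finset.card_univ, Fintype.card_fin, nsmul_eq_mul, Nat.cast_ofNat]
  · calc 6 * volume {x : X6 | bond 0 x < 1 ∧ ∀ j, j ≠ 0 → bond j x < bond 0 x}
        = ∑ _i : Fin 6, volume {x : X6 | bond 0 x < 1 ∧ ∀ j, j ≠ 0 → bond j x < bond 0 x} := by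
          rw [Finset.sum_const, Finset.card_univ, Fintype.card_fin, nsmul_eq_mul, Nat.cast_ofNat]
      _ = ∑ i : Fin 6, volume {x : X6 | bond i x < 1 ∧ ∀ j, j ≠ i → bond j x < bond i x} :=
          (Finset.sum_congr rfl fun i _ => volume_P_eq i).symm
      _ = volume (⋃ i, {x : X6 | bond i x < 1 ∧ ∀ j, j ≠ i → bond j x < bond i x}) := by
          rw [measure_iUnion pairwise_disjoint_P measurableSet_P, tsum_fintype]
      _ ≤ volume {x : X6 | ∀ i, bond i x < 1} :=
          measure_mono (iUnion_subset P_subset_star)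


/-! ### The strict piece `P 0` by slices: scaling and rotation -/

/-- Membership in the strict piece `P 0`, unfolded. [folklore] -/
theorem mem_P0_iff (x : X6) :
    x ∈ {x : X6 | bond 0 x < 1 ∧ ∀ j, j ≠ 0 → bond j x < bond 0 x} ↔
      x.1.1 ^ 2 + x.1.2 ^ 2 < 1 ∧
      x.2.1.1 ^ 2 + x.2.1.2 ^ 2 < x.1.1 ^ 2 + x.1.2 ^ 2 ∧
      x.2.2.1 ^ 2 + x.2.2.2 ^ 2 < x.1.1 ^ 2 + x.1.2 ^ 2 ∧
      (x.1.1 - x.2.1.1) ^ 2 + (x.1.2 - x.2.1.2) ^ 2 < x.1.1 ^ 2 + x.1.2 ^ 2 ∧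
      (x.1.1 - x.2.2.1) ^ 2 + (x.1.2 - x.2.2.2) ^ 2 < x.1.1 ^ 2 + x.1.2 ^ 2 ∧
      (x.2.1.1 - x.2.2.1) ^ 2 + (x.2.1.2 - x.2.2.2) ^ 2 < x.1.1 ^ 2 + x.1.2 ^ 2 := by
  simp only [mem_setOf_eq]
  constructor
  · rintro ⟨h0, h⟩
    exact ⟨h0, h 1 (by decide), h 2 (by decide), h 3 (by decide), h 4 (by decide),
      h 5 (by decide)⟩
  · rintro ⟨h0, h1, h2, h3, h4, h5⟩
    refine ⟨h0, fun j hj => ?_⟩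
    fin_cases j
    · exact absurd rfl hj
    · exact h1
    · exact h2
    · exact h3
    · exact h4
    · exact h5

/-- The standard set `Std = {(y, z) | |y|,|z| < 1, |y − e|,|z − e| < 1, |y − z| < 1}`,
`e = (1, 0)` (pairs of points of the unit-distance lens at mutual distance `< 1`) is measurable.
[folklore] -/
theorem measurableSet_std : MeasurableSet {w : (ℝ × ℝ) × (ℝ × ℝ) |
    w.1.1 ^ 2 + w.1.2 ^ 2 < 1 ∧ w.2.1 ^ 2 + w.2.2 ^ 2 < 1 ∧
    (1 - w.1.1) ^ 2 + (0 - w.1.2) ^ 2 < 1 ∧ (1 - w.2.1) ^ 2 + (0 - w.2.2) ^ 2 < 1 ∧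
    (w.1.1 - w.2.1) ^ 2 + (w.1.2 - w.2.2) ^ 2 < 1} := by
  simp only [setOf_and]
  refine MeasurableSet.inter ?_ (MeasurableSet.inter ?_ (MeasurableSet.inter ?_
    (MeasurableSet.inter ?_ ?_))) <;>
    exact measurableSet_lt (by fun_prop) (by fun_prop)

/-- **Scaling and rotation of the slices.** The `r₂`-slice of `P 0` at `p` is the image of the
standard set under (complex) multiplication by `p`, of Jacobian `|p|⁴`; it is empty if `|p| ≥ 1`.
[folklore] -/
theorem volume_slice_P0 (p : ℝ × ℝ) :
    volume (Prod.mk p ⁻¹' {x : X6 | bond 0 x < 1 ∧ ∀ j, j ≠ 0 → bond j x < bond 0 x}) =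
      if p.1 ^ 2 + p.2 ^ 2 < 1 then ENNReal.ofReal ((p.1 ^ 2 + p.2 ^ 2) ^ 2) *
        volume {w : (ℝ × ℝ) × (ℝ × ℝ) |
          w.1.1 ^ 2 + w.1.2 ^ 2 < 1 ∧ w.2.1 ^ 2 + w.2.2 ^ 2 < 1 ∧
          (1 - w.1.1) ^ 2 + (0 - w.1.2) ^ 2 < 1 ∧ (1 - w.2.1) ^ 2 + (0 - w.2.2) ^ 2 < 1 ∧
          (w.1.1 - w.2.1) ^ 2 + (w.1.2 - w.2.2) ^ 2 < 1} else 0 := by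
  split_ifs with hp
  · rcases eq_or_lt_of_le (by positivity : 0 ≤ p.1 ^ 2 + p.2 ^ 2) with h0 | hpos
    · have hem : Prod.mk p ⁻¹' {x : X6 | bond 0 x < 1 ∧ ∀ j, j ≠ 0 → bond j x < bond 0 x} = ∅ := by
        ext w
        rw [mem_preimage, mem_P0_iff]
        simp only [mem_empty_iff_false, iff_false, not_and]
        intro _ h1
        nlinarith [sq_nonneg w.1.1, sq_nonneg w.1.2]
      rw [hem, measure_empty, ← h0]
      simp
    · haveI : (volume : Measure ((ℝ × ℝ) × (ℝ × ℝ))).IsAddHaarMeasure :=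
        Measure.prod.instIsAddHaarMeasure _ _
      have htne : p.1 ^ 2 + p.2 ^ 2 ≠ 0 := hpos.ne'
      let N : (ℝ × ℝ) →ₗ[ℝ] (ℝ × ℝ) := Matrix.toLin (Module.Basis.finTwoProd ℝ)
        (Module.Basis.finTwoProd ℝ) !![p.1 / (p.1 ^ 2 + p.2 ^ 2), p.2 / (p.1 ^ 2 + p.2 ^ 2);
          -p.2 / (p.1 ^ 2 + p.2 ^ 2), p.1 / (p.1 ^ 2 + p.2 ^ 2)]
      have hN : ∀ y : ℝ × ℝ, N y = (p.1 / (p.1 ^ 2 + p.2 ^ 2) * y.1 +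
          p.2 / (p.1 ^ 2 + p.2 ^ 2) * y.2, -p.2 / (p.1 ^ 2 + p.2 ^ 2) * y.1 +
          p.1 / (p.1 ^ 2 + p.2 ^ 2) * y.2) := fun y => Matrix.toLin_finTwoProd_apply _ _ _ _ y
      have e1 : ∀ y : ℝ × ℝ, (N y).1 ^ 2 + (N y).2 ^ 2 =
          (y.1 ^ 2 + y.2 ^ 2) / (p.1 ^ 2 + p.2 ^ 2) := by
        intro y; rw [hN]; field_simp; ring
      have e2 : ∀ y : ℝ × ℝ, (1 - (N y).1) ^ 2 + (0 - (N y).2) ^ 2 =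
          ((p.1 - y.1) ^ 2 + (p.2 - y.2) ^ 2) / (p.1 ^ 2 + p.2 ^ 2) := by
        intro y; rw [hN]; field_simp; ring
      have e3 : ∀ y z : ℝ × ℝ, ((N y).1 - (N z).1) ^ 2 + ((N y).2 - (N z).2) ^ 2 =
          ((y.1 - z.1) ^ 2 + (y.2 - z.2) ^ 2) / (p.1 ^ 2 + p.2 ^ 2) := by
        intro y z; rw [hN, hN]; field_simp; ring
      have hpre : Prod.mk p ⁻¹' {x : X6 | bond 0 x < 1 ∧ ∀ j, j ≠ 0 → bond j x < bond 0 x} =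
          (N.prodMap N) ⁻¹' {w : (ℝ × ℝ) × (ℝ × ℝ) |
            w.1.1 ^ 2 + w.1.2 ^ 2 < 1 ∧ w.2.1 ^ 2 + w.2.2 ^ 2 < 1 ∧
            (1 - w.1.1) ^ 2 + (0 - w.1.2) ^ 2 < 1 ∧ (1 - w.2.1) ^ 2 + (0 - w.2.2) ^ 2 < 1 ∧
            (w.1.1 - w.2.1) ^ 2 + (w.1.2 - w.2.2) ^ 2 < 1} := by
        ext ⟨y, z⟩
        rw [mem_preimage, mem_P0_iff, mem_preimage, LinearMap.prodMap_apply, mem_setOf_eq]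
        dsimp only
        rw [e1, e1, e2, e2, e3, div_lt_one hpos, div_lt_one hpos, div_lt_one hpos,
          div_lt_one hpos, div_lt_one hpos]
        exact ⟨fun ⟨_, h1, h2, h3, h4, h5⟩ => ⟨h1, h2, h3, h4, h5⟩,
          fun ⟨h1, h2, h3, h4, h5⟩ => ⟨hp, h1, h2, h3, h4, h5⟩⟩
      have hdetN : LinearMap.det N = 1 / (p.1 ^ 2 + p.2 ^ 2) := by
        rw [LinearMap.det_toLin, Matrix.det_fin_two_of]
        field_simp
        ring
      have hdet : LinearMap.det (N.prodMap N) = ((p.1 ^ 2 + p.2 ^ 2) ^ 2)⁻¹ := by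
        rw [LinearMap.det_prodMap, hdetN, one_div, ← pow_two, inv_pow]
      have hdet0 : LinearMap.det (N.prodMap N) ≠ 0 := by rw [hdet]; positivity
      rw [hpre, Measure.addHaar_preimage_linearMap _ hdet0, hdet]
      congr 1
      rw [inv_inv, abs_of_nonneg (by positivity)]
  · have hem : Prod.mk p ⁻¹' {x : X6 | bond 0 x < 1 ∧ ∀ j, j ≠ 0 → bond j x < bond 0 x} = ∅ := by
      ext w
      rw [mem_preimage, mem_P0_iff]
      simp only [mem_empty_iff_false, iff_false, not_and]
      intro h0
      exact absurd h0 hp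
    rw [hem, measure_empty]

/-- **Volume of the strict piece:** `vol (P 0) = (π/3) · vol Std`
(Tonelli over `r₂`, the slice formula, and polar coordinates: `∫_{|p|<1} |p|⁴ = π/3`).
[folklore] -/
theorem volume_P0 :
    volume {x : X6 | bond 0 x < 1 ∧ ∀ j, j ≠ 0 → bond j x < bond 0 x} =
      ENNReal.ofReal (π / 3) * volume {w : (ℝ × ℝ) × (ℝ × ℝ) |
          w.1.1 ^ 2 + w.1.2 ^ 2 < 1 ∧ w.2.1 ^ 2 + w.2.2 ^ 2 < 1 ∧
          (1 - w.1.1) ^ 2 + (0 - w.1.2) ^ 2 < 1 ∧ (1 - w.2.1) ^ 2 + (0 - w.2.2) ^ 2 < 1 ∧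
          (w.1.1 - w.2.1) ^ 2 + (w.1.2 - w.2.2) ^ 2 < 1} := by
  rw [Measure.volume_eq_prod, Measure.prod_apply (measurableSet_P 0)]
  simp_rw [volume_slice_P0]
  set V := volume {w : (ℝ × ℝ) × (ℝ × ℝ) |
          w.1.1 ^ 2 + w.1.2 ^ 2 < 1 ∧ w.2.1 ^ 2 + w.2.2 ^ 2 < 1 ∧
          (1 - w.1.1) ^ 2 + (0 - w.1.2) ^ 2 < 1 ∧ (1 - w.2.1) ^ 2 + (0 - w.2.2) ^ 2 < 1 ∧
          (w.1.1 - w.2.1) ^ 2 + (w.1.2 - w.2.2) ^ 2 < 1} with hV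
  rw [lintegral_radial (fun t => if t < 1 then ENNReal.ofReal (t ^ 2) * V else 0)
    (Measurable.ite measurableSet_Iio (by fun_prop) measurable_const)]
  have heq : ∀ r ∈ Ioi (0:ℝ), ENNReal.ofReal r *
      (if r ^ 2 < 1 then ENNReal.ofReal ((r ^ 2) ^ 2) * V else 0) =
      (Iio (1:ℝ)).indicator (fun r => ENNReal.ofReal (r ^ 5) * V) r := by
    intro r hr
    have hr0 : 0 ≤ r := le_of_lt hr
    by_cases h1 : r < 1
    · rw [if_pos (by nlinarith), indicator_of_mem (mem_Iio.2 h1), ← mul_assoc,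
        ← ENNReal.ofReal_mul hr0]
      congr 2; ring
    · rw [if_neg (fun h => h1 (by nlinarith)), indicator_of_notMem (by simpa using h1), mul_zero]
  rw [setLIntegral_congr_fun measurableSet_Ioi heq, lintegral_indicator measurableSet_Iio,
    Measure.restrict_restrict measurableSet_Iio, Iio_inter_Ioi,
    lintegral_mul_const _ (by fun_prop), ← mul_assoc]
  congr 1
  have h5 : ∫⁻ r in Ioo (0:ℝ) 1, ENNReal.ofReal (r ^ 5) = ENNReal.ofReal (1 / 6) := by
    rw [← ofReal_integral_eq_lintegral_ofReal
      ((continuous_pow 5).integrableOn_Icc.mono_set Ioo_subset_Icc_self)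
      (by filter_upwards [ae_restrict_mem measurableSet_Ioo] with r hr; exact pow_nonneg hr.1.le 5),
      ← integral_Ioc_eq_integral_Ioo, ← intervalIntegral.integral_of_le zero_le_one, integral_pow]
    norm_num
  rw [h5, ← ENNReal.ofReal_mul (by positivity)]
  congr 1; ring

/-- The star set in product coordinates, as an explicit set of conjunctions. [folklore] -/
theorem starSet_eq : {x : X6 | x.1.1 ^ 2 + x.1.2 ^ 2 < 1 ∧ x.2.1.1 ^ 2 + x.2.1.2 ^ 2 < 1 ∧
      x.2.2.1 ^ 2 + x.2.2.2 ^ 2 < 1 ∧ (x.1.1 - x.2.1.1) ^ 2 + (x.1.2 - x.2.1.2) ^ 2 < 1 ∧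
      (x.1.1 - x.2.2.1) ^ 2 + (x.1.2 - x.2.2.2) ^ 2 < 1 ∧
      (x.2.1.1 - x.2.2.1) ^ 2 + (x.2.1.2 - x.2.2.2) ^ 2 < 1} = {x : X6 | ∀ i, bond i x < 1} := by
  ext x
  simp only [mem_setOf_eq]
  constructor
  · rintro ⟨h0, h1, h2, h3, h4, h5⟩ i
    fin_cases i
    · exact h0
    · exact h1
    · exact h2
    · exact h3
    · exact h4
    · exact h5
  · intro h
    exact ⟨h 0, h 1, h 2, h 3, h 4, h 5⟩

/-- **The complete star reduced to the standard set:** `vol(star) = 2π · vol Std`. [folklore] -/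
theorem volume_starProd :
    volume {x : X6 | x.1.1 ^ 2 + x.1.2 ^ 2 < 1 ∧ x.2.1.1 ^ 2 + x.2.1.2 ^ 2 < 1 ∧
      x.2.2.1 ^ 2 + x.2.2.2 ^ 2 < 1 ∧ (x.1.1 - x.2.1.1) ^ 2 + (x.1.2 - x.2.1.2) ^ 2 < 1 ∧
      (x.1.1 - x.2.2.1) ^ 2 + (x.1.2 - x.2.2.2) ^ 2 < 1 ∧
      (x.2.1.1 - x.2.2.1) ^ 2 + (x.2.1.2 - x.2.2.2) ^ 2 < 1} =
      ENNReal.ofReal (2 * π) * volume {w : (ℝ × ℝ) × (ℝ × ℝ) |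
          w.1.1 ^ 2 + w.1.2 ^ 2 < 1 ∧ w.2.1 ^ 2 + w.2.2 ^ 2 < 1 ∧
          (1 - w.1.1) ^ 2 + (0 - w.1.2) ^ 2 < 1 ∧ (1 - w.2.1) ^ 2 + (0 - w.2.2) ^ 2 < 1 ∧
          (w.1.1 - w.2.1) ^ 2 + (w.1.2 - w.2.2) ^ 2 < 1} := by
  rw [starSet_eq, volume_star_eq_six_mul, volume_P0, ← mul_assoc]
  congr 1
  rw [show (6 : ℝ≥0∞) = ENNReal.ofReal 6 by norm_num, ← ENNReal.ofReal_mul (by norm_num)]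
  congr 1; ring

end Star


/-! ## The standard set: `vol Std = A(1)² − vol Far`, and `Far` by slices -/

section Std

/-- The unit-distance lens `D(0) ∩ D(e)` has area `2π/3 − √3/2`. [folklore] -/
theorem volume_unitLens :
    volume {q : ℝ × ℝ | q.1 ^ 2 + q.2 ^ 2 < 1 ∧ (1 - q.1) ^ 2 + (0 - q.2) ^ 2 < 1} =
      ENNReal.ofReal (2 * π / 3 - Real.sqrt 3 / 2) := by
  rw [volume_lensAt_eq]
  have h1 : Real.sqrt (1 ^ 2 + 0 ^ 2) = 1 := by simp
  rw [h1]
  have h2 : Real.arcsin (1 / 2) = π / 6 := by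
    rw [← Real.sin_pi_div_six]
    exact Real.arcsin_sin (by linarith [Real.pi_pos]) (by linarith [Real.pi_pos])
  have h3 : Real.sqrt (1 - (1 / 2) ^ 2) = Real.sqrt 3 / 2 := by
    rw [show (1:ℝ) - (1 / 2) ^ 2 = (Real.sqrt 3 / 2) ^ 2 by
      rw [div_pow (Real.sqrt 3), Real.sq_sqrt (by norm_num : (0:ℝ) ≤ 3)]; norm_num]
    exact Real.sqrt_sq (by positivity)
  rw [h2, one_mul, h3]
  congr 1; ring

/-- The far pairs `Far = {(y, z) ∈ L × L | |y − z| ≥ 1}` form a measurable set. [folklore] -/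
theorem measurableSet_far : MeasurableSet {w : (ℝ × ℝ) × (ℝ × ℝ) |
    w.1.1 ^ 2 + w.1.2 ^ 2 < 1 ∧ (1 - w.1.1) ^ 2 + (0 - w.1.2) ^ 2 < 1 ∧
    w.2.1 ^ 2 + w.2.2 ^ 2 < 1 ∧ (1 - w.2.1) ^ 2 + (0 - w.2.2) ^ 2 < 1 ∧
    1 ≤ (w.1.1 - w.2.1) ^ 2 + (w.1.2 - w.2.2) ^ 2} := by
  simp only [setOf_and]
  refine MeasurableSet.inter ?_ (MeasurableSet.inter ?_ (MeasurableSet.inter ?_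
    (MeasurableSet.inter ?_ ?_)))
  · exact measurableSet_lt (by fun_prop) (by fun_prop)
  · exact measurableSet_lt (by fun_prop) (by fun_prop)
  · exact measurableSet_lt (by fun_prop) (by fun_prop)
  · exact measurableSet_lt (by fun_prop) (by fun_prop)
  · exact measurableSet_le (by fun_prop) (by fun_prop)

/-- `vol Std = A(1)·A(1) − vol Far` with `A(1) = 2π/3 − √3/2` the unit-distance lens area
(`Std = L × L ∖ Far`). [folklore] -/
theorem volume_std_eq :
    volume {w : (ℝ × ℝ) × (ℝ × ℝ) |
        w.1.1 ^ 2 + w.1.2 ^ 2 < 1 ∧ w.2.1 ^ 2 + w.2.2 ^ 2 < 1 ∧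
        (1 - w.1.1) ^ 2 + (0 - w.1.2) ^ 2 < 1 ∧ (1 - w.2.1) ^ 2 + (0 - w.2.2) ^ 2 < 1 ∧
        (w.1.1 - w.2.1) ^ 2 + (w.1.2 - w.2.2) ^ 2 < 1} =
      ENNReal.ofReal (2 * π / 3 - Real.sqrt 3 / 2) * ENNReal.ofReal (2 * π / 3 - Real.sqrt 3 / 2) -
      volume {w : (ℝ × ℝ) × (ℝ × ℝ) |
        w.1.1 ^ 2 + w.1.2 ^ 2 < 1 ∧ (1 - w.1.1) ^ 2 + (0 - w.1.2) ^ 2 < 1 ∧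
        w.2.1 ^ 2 + w.2.2 ^ 2 < 1 ∧ (1 - w.2.1) ^ 2 + (0 - w.2.2) ^ 2 < 1 ∧
        1 ≤ (w.1.1 - w.2.1) ^ 2 + (w.1.2 - w.2.2) ^ 2} := by
  have hstd : {w : (ℝ × ℝ) × (ℝ × ℝ) |
        w.1.1 ^ 2 + w.1.2 ^ 2 < 1 ∧ w.2.1 ^ 2 + w.2.2 ^ 2 < 1 ∧
        (1 - w.1.1) ^ 2 + (0 - w.1.2) ^ 2 < 1 ∧ (1 - w.2.1) ^ 2 + (0 - w.2.2) ^ 2 < 1 ∧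
        (w.1.1 - w.2.1) ^ 2 + (w.1.2 - w.2.2) ^ 2 < 1} =
      ({q : ℝ × ℝ | q.1 ^ 2 + q.2 ^ 2 < 1 ∧ (1 - q.1) ^ 2 + (0 - q.2) ^ 2 < 1} ×ˢ
        {q : ℝ × ℝ | q.1 ^ 2 + q.2 ^ 2 < 1 ∧ (1 - q.1) ^ 2 + (0 - q.2) ^ 2 < 1}) \
      {w : (ℝ × ℝ) × (ℝ × ℝ) |
        w.1.1 ^ 2 + w.1.2 ^ 2 < 1 ∧ (1 - w.1.1) ^ 2 + (0 - w.1.2) ^ 2 < 1 ∧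
        w.2.1 ^ 2 + w.2.2 ^ 2 < 1 ∧ (1 - w.2.1) ^ 2 + (0 - w.2.2) ^ 2 < 1 ∧
        1 ≤ (w.1.1 - w.2.1) ^ 2 + (w.1.2 - w.2.2) ^ 2} := by
    ext w
    simp only [mem_setOf_eq, Set.mem_sdiff, mem_prod, not_and, not_le]
    constructor
    · rintro ⟨h1, h2, h3, h4, h5⟩
      exact ⟨⟨⟨h1, h3⟩, ⟨h2, h4⟩⟩, fun _ _ _ _ => h5⟩
    · rintro ⟨⟨⟨h1, h3⟩, ⟨h2, h4⟩⟩, h5⟩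
      exact ⟨h1, h2, h3, h4, h5 h1 h3 h2 h4⟩
  have hLL : volume ({q : ℝ × ℝ | q.1 ^ 2 + q.2 ^ 2 < 1 ∧ (1 - q.1) ^ 2 + (0 - q.2) ^ 2 < 1} ×ˢ
        {q : ℝ × ℝ | q.1 ^ 2 + q.2 ^ 2 < 1 ∧ (1 - q.1) ^ 2 + (0 - q.2) ^ 2 < 1}) =
      ENNReal.ofReal (2 * π / 3 - Real.sqrt 3 / 2) *
        ENNReal.ofReal (2 * π / 3 - Real.sqrt 3 / 2) := by
    rw [Measure.volume_eq_prod, Measure.prod_prod, volume_unitLens]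
  have hsub : {w : (ℝ × ℝ) × (ℝ × ℝ) |
        w.1.1 ^ 2 + w.1.2 ^ 2 < 1 ∧ (1 - w.1.1) ^ 2 + (0 - w.1.2) ^ 2 < 1 ∧
        w.2.1 ^ 2 + w.2.2 ^ 2 < 1 ∧ (1 - w.2.1) ^ 2 + (0 - w.2.2) ^ 2 < 1 ∧
        1 ≤ (w.1.1 - w.2.1) ^ 2 + (w.1.2 - w.2.2) ^ 2} ⊆
      {q : ℝ × ℝ | q.1 ^ 2 + q.2 ^ 2 < 1 ∧ (1 - q.1) ^ 2 + (0 - q.2) ^ 2 < 1} ×ˢ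
        {q : ℝ × ℝ | q.1 ^ 2 + q.2 ^ 2 < 1 ∧ (1 - q.1) ^ 2 + (0 - q.2) ^ 2 < 1} := by
    rintro w ⟨h1, h2, h3, h4, -⟩
    exact ⟨⟨h1, h2⟩, ⟨h3, h4⟩⟩
  have hfin : volume {w : (ℝ × ℝ) × (ℝ × ℝ) |
        w.1.1 ^ 2 + w.1.2 ^ 2 < 1 ∧ (1 - w.1.1) ^ 2 + (0 - w.1.2) ^ 2 < 1 ∧
        w.2.1 ^ 2 + w.2.2 ^ 2 < 1 ∧ (1 - w.2.1) ^ 2 + (0 - w.2.2) ^ 2 < 1 ∧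
        1 ≤ (w.1.1 - w.2.1) ^ 2 + (w.1.2 - w.2.2) ^ 2} ≠ ⊤ := by
    refine ((measure_mono hsub).trans_lt ?_).ne
    rw [hLL]
    exact ENNReal.mul_lt_top ENNReal.ofReal_lt_top ENNReal.ofReal_lt_top
  rw [hstd, measure_sdiff hsub measurableSet_far.nullMeasurableSet hfin, hLL]

/-! ### The far pairs by slices over the first coordinates -/

/-- The coordinate shuffle `((u,v),(u',v')) ↦ ((u,u'),(v,v'))` preserves Lebesgue measure on
`(ℝ × ℝ) × (ℝ × ℝ)`. [folklore] -/
theorem measurePreserving_shuffle :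
    MeasurePreserving (fun w : (ℝ × ℝ) × (ℝ × ℝ) => ((w.1.1, w.2.1), (w.1.2, w.2.2)))
      volume volume := by
  have hφ : Measurable (fun w : (ℝ × ℝ) × (ℝ × ℝ) => ((w.1.1, w.2.1), (w.1.2, w.2.2))) := by
    fun_prop
  refine ⟨hφ, ?_⟩
  symm
  apply Measure.prod_eq
  intro s t hs ht
  rw [Measure.map_apply hφ (hs.prod ht), Measure.volume_eq_prod,
    Measure.prod_apply (hφ (hs.prod ht))]
  have hsec : ∀ a : ℝ × ℝ, Prod.mk a ⁻¹'
      ((fun w : (ℝ × ℝ) × (ℝ × ℝ) => ((w.1.1, w.2.1), (w.1.2, w.2.2))) ⁻¹' (s ×ˢ t)) =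
      (Prod.mk a.1 ⁻¹' s) ×ˢ (Prod.mk a.2 ⁻¹' t) := by
    intro a; ext q; simp [mem_prod]
  have hpp : ∀ a : ℝ × ℝ, volume ((Prod.mk a.1 ⁻¹' s) ×ˢ (Prod.mk a.2 ⁻¹' t)) =
      volume (Prod.mk a.1 ⁻¹' s) * volume (Prod.mk a.2 ⁻¹' t) := fun a => by
    rw [Measure.volume_eq_prod, Measure.prod_prod]
  simp_rw [hsec, hpp]
  rw [Measure.volume_eq_prod, lintegral_prod_mul (measurable_measure_prodMk_left hs).aemeasurable
    (measurable_measure_prodMk_left ht).aemeasurable, ← Measure.prod_apply hs,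
    ← Measure.prod_apply ht]

/-- The far pairs in the shuffled coordinates `((u, u'), (v, v'))` form a measurable set.
[folklore] -/
theorem measurableSet_far2 : MeasurableSet {w : (ℝ × ℝ) × (ℝ × ℝ) |
    w.1.1 ^ 2 + w.2.1 ^ 2 < 1 ∧ (1 - w.1.1) ^ 2 + (0 - w.2.1) ^ 2 < 1 ∧
    w.1.2 ^ 2 + w.2.2 ^ 2 < 1 ∧ (1 - w.1.2) ^ 2 + (0 - w.2.2) ^ 2 < 1 ∧
    1 ≤ (w.1.1 - w.1.2) ^ 2 + (w.2.1 - w.2.2) ^ 2} := by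
  simp only [setOf_and]
  refine MeasurableSet.inter ?_ (MeasurableSet.inter ?_ (MeasurableSet.inter ?_
    (MeasurableSet.inter ?_ ?_)))
  · exact measurableSet_lt (by fun_prop) (by fun_prop)
  · exact measurableSet_lt (by fun_prop) (by fun_prop)
  · exact measurableSet_lt (by fun_prop) (by fun_prop)
  · exact measurableSet_lt (by fun_prop) (by fun_prop)
  · exact measurableSet_le (by fun_prop) (by fun_prop)

/-- `vol Far` in the original and in the shuffled coordinates agree. [folklore] -/
theorem volume_far_eq_far2 :
    volume {w : (ℝ × ℝ) × (ℝ × ℝ) |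
        w.1.1 ^ 2 + w.1.2 ^ 2 < 1 ∧ (1 - w.1.1) ^ 2 + (0 - w.1.2) ^ 2 < 1 ∧
        w.2.1 ^ 2 + w.2.2 ^ 2 < 1 ∧ (1 - w.2.1) ^ 2 + (0 - w.2.2) ^ 2 < 1 ∧
        1 ≤ (w.1.1 - w.2.1) ^ 2 + (w.1.2 - w.2.2) ^ 2} =
      volume {w : (ℝ × ℝ) × (ℝ × ℝ) |
        w.1.1 ^ 2 + w.2.1 ^ 2 < 1 ∧ (1 - w.1.1) ^ 2 + (0 - w.2.1) ^ 2 < 1 ∧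
        w.1.2 ^ 2 + w.2.2 ^ 2 < 1 ∧ (1 - w.1.2) ^ 2 + (0 - w.2.2) ^ 2 < 1 ∧
        1 ≤ (w.1.1 - w.1.2) ^ 2 + (w.2.1 - w.2.2) ^ 2} := by
  rw [← measurePreserving_shuffle.measure_preimage measurableSet_far2.nullMeasurableSet]
  rfl

/-- Area of `{|v| < m, |v'| < m', |v − v'| ≥ c}` for `0 < m ≤ c`, `0 < m' ≤ c`: two corner
triangles with legs `m + m' − c` (empty if `c ≥ m + m'`). [folklore] -/
theorem volume_section_far {m m' c : ℝ} (hm : 0 < m) (hm' : 0 < m') (hmc : m ≤ c)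
    (hm'c : m' ≤ c) :
    volume {q : ℝ × ℝ | q.1 ^ 2 < m ^ 2 ∧ q.2 ^ 2 < m' ^ 2 ∧ c ^ 2 ≤ (q.1 - q.2) ^ 2} =
      ENNReal.ofReal ((max (m + m' - c) 0) ^ 2) := by
  have hc : 0 < c := hm.trans_le hmc
  have hmeas : MeasurableSet {q : ℝ × ℝ | q.1 ^ 2 < m ^ 2 ∧ q.2 ^ 2 < m' ^ 2 ∧
      c ^ 2 ≤ (q.1 - q.2) ^ 2} := by
    simp only [setOf_and]
    exact (measurableSet_lt (by fun_prop) (by fun_prop)).inter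
      ((measurableSet_lt (by fun_prop) (by fun_prop)).inter
        (measurableSet_le (by fun_prop) (by fun_prop)))
  rw [Measure.volume_eq_prod, Measure.prod_apply hmeas]
  have hvol : ∀ v : ℝ, volume (Prod.mk v ⁻¹' {q : ℝ × ℝ | q.1 ^ 2 < m ^ 2 ∧ q.2 ^ 2 < m' ^ 2 ∧
      c ^ 2 ≤ (q.1 - q.2) ^ 2}) = (Ioo (-m) m).indicator
      (fun v => ENNReal.ofReal (v - (c - m')) + ENNReal.ofReal ((m' - c) - v)) v := by
    intro v
    by_cases hv : v ∈ Ioo (-m) m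
    · rw [indicator_of_mem hv]
      have hset : Prod.mk v ⁻¹' {q : ℝ × ℝ | q.1 ^ 2 < m ^ 2 ∧ q.2 ^ 2 < m' ^ 2 ∧
          c ^ 2 ≤ (q.1 - q.2) ^ 2} = Ioc (-m') (v - c) ∪ Ico (v + c) m' := by
        ext v'
        simp only [mem_preimage, mem_setOf_eq, mem_union, mem_Ioc, mem_Ico]
        have hv2 : v ^ 2 < m ^ 2 := sq_lt_sq' hv.1 hv.2
        constructor
        · rintro ⟨-, h1, h2⟩
          have ha : |v'| < m' := abs_lt_of_sq_lt_sq h1 hm'.le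
          have hb : c ≤ |v - v'| := by
            have := sq_le_sq.1 h2
            rwa [abs_of_pos hc] at this
          rcases le_abs.1 hb with h | h
          · left; exact ⟨(abs_lt.1 ha).1, by linarith⟩
          · right; exact ⟨by linarith, (abs_lt.1 ha).2⟩
        · rintro (⟨h1, h2⟩ | ⟨h1, h2⟩)
          · refine ⟨hv2, sq_lt_sq' h1 (by linarith [hv.2]), ?_⟩
            nlinarith
          · refine ⟨hv2, sq_lt_sq' (by linarith [hv.1]) h2, ?_⟩
            nlinarith
      have hdisj : Disjoint (Ioc (-m') (v - c)) (Ico (v + c) m') :=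
        disjoint_left.2 fun x h1 h2 => by linarith [h1.2, h2.1]
      rw [hset, measure_union hdisj measurableSet_Ico, Real.volume_Ioc, Real.volume_Ico]
      congr 2 <;> ring
    · rw [indicator_of_notMem hv]
      have hset : Prod.mk v ⁻¹' {q : ℝ × ℝ | q.1 ^ 2 < m ^ 2 ∧ q.2 ^ 2 < m' ^ 2 ∧
          c ^ 2 ≤ (q.1 - q.2) ^ 2} = ∅ := by
        ext v'
        simp only [mem_preimage, mem_setOf_eq, mem_empty_iff_false, iff_false, not_and]
        intro h1
        exact absurd (abs_lt.1 (abs_lt_of_sq_lt_sq h1 hm.le)) (fun h => hv ⟨h.1, h.2⟩)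
      rw [hset, measure_empty]
  simp_rw [hvol]
  rw [lintegral_indicator measurableSet_Ioo, lintegral_add_left (by fun_prop),
    lintegral_ofReal_sub_Ioo (by linarith), lintegral_ofReal_sub_Ioo' (by linarith),
    ← ENNReal.ofReal_add (by positivity) (by positivity)]
  congr 1
  rw [show m - (c - m') = m + m' - c by ring, show m' - c - -m = m + m' - c by ring]
  ring

/-- The `(u, u')`-slices of the far pairs: for `u, u' ∈ (0, 1)` the section
`{|v| < m(u), |v'| < m(u'), |v − v'| ≥ c(u, u')}` with `m(u)² = 1 − max(u², (1−u)²)`,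
`c² = 1 − (u − u')²`, of area `(m(u) + m(u') − c)₊²`; empty otherwise. [folklore] -/
theorem volume_slice_far2 (z : ℝ × ℝ) :
    volume (Prod.mk z ⁻¹' {w : (ℝ × ℝ) × (ℝ × ℝ) |
        w.1.1 ^ 2 + w.2.1 ^ 2 < 1 ∧ (1 - w.1.1) ^ 2 + (0 - w.2.1) ^ 2 < 1 ∧
        w.1.2 ^ 2 + w.2.2 ^ 2 < 1 ∧ (1 - w.1.2) ^ 2 + (0 - w.2.2) ^ 2 < 1 ∧
        1 ≤ (w.1.1 - w.1.2) ^ 2 + (w.2.1 - w.2.2) ^ 2}) =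
      (Ioo (0:ℝ) 1 ×ˢ Ioo (0:ℝ) 1).indicator (fun z => ENNReal.ofReal
        ((max (Real.sqrt (1 - max (z.1 ^ 2) ((1 - z.1) ^ 2)) +
          Real.sqrt (1 - max (z.2 ^ 2) ((1 - z.2) ^ 2)) - Real.sqrt (1 - (z.1 - z.2) ^ 2)) 0) ^ 2))
        z := by
  by_cases hz : z ∈ Ioo (0:ℝ) 1 ×ˢ Ioo (0:ℝ) 1
  · rw [indicator_of_mem hz]
    obtain ⟨⟨hu0, hu1⟩, ⟨hu0', hu1'⟩⟩ := hz
    have hM : max (z.1 ^ 2) ((1 - z.1) ^ 2) < 1 := max_lt (by nlinarith) (by nlinarith)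
    have hM' : max (z.2 ^ 2) ((1 - z.2) ^ 2) < 1 := max_lt (by nlinarith) (by nlinarith)
    have hd : (z.1 - z.2) ^ 2 ≤ max (z.1 ^ 2) ((1 - z.1) ^ 2) := by
      rcases le_or_gt z.2 z.1 with h | h
      · exact le_max_of_le_left (by nlinarith)
      · exact le_max_of_le_right (by nlinarith)
    have hd' : (z.1 - z.2) ^ 2 ≤ max (z.2 ^ 2) ((1 - z.2) ^ 2) := by
      rcases le_or_gt z.1 z.2 with h | h
      · exact le_max_of_le_left (by nlinarith)
      · exact le_max_of_le_right (by nlinarith)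
    set m := Real.sqrt (1 - max (z.1 ^ 2) ((1 - z.1) ^ 2)) with hm
    set m' := Real.sqrt (1 - max (z.2 ^ 2) ((1 - z.2) ^ 2)) with hm'
    set c := Real.sqrt (1 - (z.1 - z.2) ^ 2) with hc
    have hmsq : m ^ 2 = 1 - max (z.1 ^ 2) ((1 - z.1) ^ 2) := Real.sq_sqrt (by linarith)
    have hm'sq : m' ^ 2 = 1 - max (z.2 ^ 2) ((1 - z.2) ^ 2) := Real.sq_sqrt (by linarith)
    have hcsq : c ^ 2 = 1 - (z.1 - z.2) ^ 2 := Real.sq_sqrt (by linarith [hd, hM])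
    have hset : Prod.mk z ⁻¹' {w : (ℝ × ℝ) × (ℝ × ℝ) |
        w.1.1 ^ 2 + w.2.1 ^ 2 < 1 ∧ (1 - w.1.1) ^ 2 + (0 - w.2.1) ^ 2 < 1 ∧
        w.1.2 ^ 2 + w.2.2 ^ 2 < 1 ∧ (1 - w.1.2) ^ 2 + (0 - w.2.2) ^ 2 < 1 ∧
        1 ≤ (w.1.1 - w.1.2) ^ 2 + (w.2.1 - w.2.2) ^ 2} =
        {q : ℝ × ℝ | q.1 ^ 2 < m ^ 2 ∧ q.2 ^ 2 < m' ^ 2 ∧ c ^ 2 ≤ (q.1 - q.2) ^ 2} := by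
      ext q
      simp only [mem_preimage, mem_setOf_eq, hmsq, hm'sq, hcsq]
      have e1 := le_max_left (z.1 ^ 2) ((1 - z.1) ^ 2)
      have e2 := le_max_right (z.1 ^ 2) ((1 - z.1) ^ 2)
      have e1' := le_max_left (z.2 ^ 2) ((1 - z.2) ^ 2)
      have e2' := le_max_right (z.2 ^ 2) ((1 - z.2) ^ 2)
      constructor
      · rintro ⟨h1, h2, h3, h4, h5⟩
        refine ⟨?_, ?_, by nlinarith⟩
        · rcases max_choice (z.1 ^ 2) ((1 - z.1) ^ 2) with h | h <;> rw [h] <;> nlinarith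
        · rcases max_choice (z.2 ^ 2) ((1 - z.2) ^ 2) with h | h <;> rw [h] <;> nlinarith
      · rintro ⟨h1, h2, h3⟩
        exact ⟨by nlinarith, by nlinarith, by nlinarith, by nlinarith, by nlinarith⟩
    rw [hset]
    exact volume_section_far (Real.sqrt_pos.2 (by linarith)) (Real.sqrt_pos.2 (by linarith))
      (Real.sqrt_le_sqrt (by linarith)) (Real.sqrt_le_sqrt (by linarith))
  · rw [indicator_of_notMem hz]
    have hset : Prod.mk z ⁻¹' {w : (ℝ × ℝ) × (ℝ × ℝ) |
        w.1.1 ^ 2 + w.2.1 ^ 2 < 1 ∧ (1 - w.1.1) ^ 2 + (0 - w.2.1) ^ 2 < 1 ∧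
        w.1.2 ^ 2 + w.2.2 ^ 2 < 1 ∧ (1 - w.1.2) ^ 2 + (0 - w.2.2) ^ 2 < 1 ∧
        1 ≤ (w.1.1 - w.1.2) ^ 2 + (w.2.1 - w.2.2) ^ 2} = ∅ := by
      ext q
      simp only [mem_preimage, mem_setOf_eq, mem_empty_iff_false, iff_false, not_and]
      intro h1 h2 h3 h4 _
      apply hz
      refine ⟨⟨?_, ?_⟩, ⟨?_, ?_⟩⟩ <;> nlinarith [sq_nonneg q.1, sq_nonneg q.2]
    rw [hset, measure_empty]

/-- **The far pairs as a double integral**: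
`vol Far = ∫∫_{(0,1)²} (m(u) + m(u') − c(u,u'))₊² du du'`. [folklore] -/
theorem volume_far2_eq_lintegral :
    volume {w : (ℝ × ℝ) × (ℝ × ℝ) |
        w.1.1 ^ 2 + w.2.1 ^ 2 < 1 ∧ (1 - w.1.1) ^ 2 + (0 - w.2.1) ^ 2 < 1 ∧
        w.1.2 ^ 2 + w.2.2 ^ 2 < 1 ∧ (1 - w.1.2) ^ 2 + (0 - w.2.2) ^ 2 < 1 ∧
        1 ≤ (w.1.1 - w.1.2) ^ 2 + (w.2.1 - w.2.2) ^ 2} =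
      ∫⁻ z in Ioo (0:ℝ) 1 ×ˢ Ioo (0:ℝ) 1, ENNReal.ofReal
        ((max (Real.sqrt (1 - max (z.1 ^ 2) ((1 - z.1) ^ 2)) +
          Real.sqrt (1 - max (z.2 ^ 2) ((1 - z.2) ^ 2)) -
            Real.sqrt (1 - (z.1 - z.2) ^ 2)) 0) ^ 2) := by
  rw [Measure.volume_eq_prod, Measure.prod_apply measurableSet_far2]
  simp_rw [volume_slice_far2]
  rw [lintegral_indicator (measurableSet_Ioo.prod measurableSet_Ioo)]

end Std


/-! ## The double integral `Ψ = ∫∫_{(0,1)²} (m(u) + m(u') − c)₊² = 1/4 − π²/18 + √3π/12` -/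

section Psi

/-- half-chord of the unit-distance lens at abscissa `u`: `m(u) = √(1 − max(u², (1−u)²))`. -/
local notation "mS(" u ")" => Real.sqrt (1 - max ((u) ^ 2) ((1 - (u)) ^ 2))
/-- `c(u,u') = √(1 − (u − u')²)`. -/
local notation "cT(" u "," v ")" => Real.sqrt (1 - ((u) - (v)) ^ 2)
/-- the symmetrised integrand `J = 2m² + c² + 2mm' − 4mc`. -/
local notation "J2(" u "," v ")" =>
  (2 * mS(u) ^ 2 + cT(u,v) ^ 2 + 2 * mS(u) * mS(v) - 4 * mS(u) * cT(u,v))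
/-- `R₁ = 𝟙_Ω · J`, `Ω = {c ≤ m + m'}`. -/
local notation "R1t(" u "," v ")" => (if cT(u,v) ≤ mS(u) + mS(v) then J2(u,v) else (0:ℝ))
/-- the antisymmetric remainder `R₂ = 𝟙_Ω · (m'² − m² − 2(m' − m)c)`. -/
local notation "R2t(" u "," v ")" =>
  (if cT(u,v) ≤ mS(u) + mS(v) then mS(v) ^ 2 - mS(u) ^ 2 - 2 * (mS(v) - mS(u)) * cT(u,v)
    else (0:ℝ))
/-- the closed form of the inner integral at `u = 1 − cos A`. -/
local notation "kA(" A ")" =>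
  ((1 - (1 - Real.cos (π / 3 - A))) * (2 * Real.sin A ^ 2)
    + ((Real.cos A - Real.sin (π / 6 - A)) - (Real.cos A ^ 3 - Real.sin (π / 6 - A) ^ 3) / 3)
    + 2 * Real.sin A * (((Real.cos (π / 3 - A) * Real.sin (π / 3 - A) + (π / 6 + A)) / 2
        - ((1 / 2) * (Real.sqrt 3 / 2) + π / 6) / 2)
      + (π / 4 - ((1 / 2) * (Real.sqrt 3 / 2) + π / 6) / 2))
    - 4 * Real.sin A * ((Real.cos A * Real.sin A + (π / 2 - A)) / 2
        - (Real.sin (π / 6 - A) * Real.cos (π / 6 - A) + (π / 6 - A)) / 2))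
/-- the polynomial form of `sin A · kA(A)`. -/
local notation "Tpoly(" A ")" =>
  ((-1/3:ℝ)*π + (1/8:ℝ)*Real.sqrt 3 + (1/3:ℝ)*π*Real.cos A^2 + (3/8:ℝ)*Real.sqrt 3*Real.cos A^2 +
        (-1/2:ℝ)*Real.sqrt 3*Real.cos A^4 + (-5/8:ℝ)*Real.sin A*Real.cos A +
        (5/6:ℝ)*Real.sin A*Real.cos A^3 + (1:ℝ)*A + (-1:ℝ)*A*Real.cos A^2)

/-! ### Pointwise facts -/

/-- `m` is continuous. [folklore] -/
theorem continuous_mS : Continuous fun u : ℝ => mS(u) :=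
  Real.continuous_sqrt.comp (by fun_prop)

/-- `m(1 − u) = m(u)`. [folklore] -/
theorem mS_one_sub (u : ℝ) : mS(1 - u) = mS(u) := by
  rw [show (1 - (1 - u)) = u by ring, max_comm]

/-- `m(u) = √(1 − (1−u)²)` for `u ≤ 1/2`. [folklore] -/
theorem mS_of_le_half {u : ℝ} (hu : u ≤ 1 / 2) : mS(u) = Real.sqrt (1 - (1 - u) ^ 2) := by
  rw [max_eq_right (by nlinarith)]

/-- `m(u) = √(1 − u²)` for `1/2 ≤ u`. [folklore] -/
theorem mS_of_half_le {u : ℝ} (hu : 1 / 2 ≤ u) : mS(u) = Real.sqrt (1 - u ^ 2) := by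
  rw [max_eq_left (by nlinarith)]

/-- `m(1 − cos A) = sin A` for `A ∈ [0, π/3]`. [folklore] -/
theorem mS_one_sub_cos {A : ℝ} (h0 : 0 ≤ A) (h1 : A ≤ π / 3) : mS(1 - Real.cos A) = Real.sin A := by
  have hc : 1 / 2 ≤ Real.cos A := by
    rw [← Real.cos_pi_div_three]
    exact Real.cos_le_cos_of_nonneg_of_le_pi h0 (by linarith [Real.pi_pos]) h1
  rw [mS_of_le_half (by linarith), show (1 - (1 - Real.cos A)) = Real.cos A by ring, ← Real.sin_sq,
    Real.sqrt_sq (Real.sin_nonneg_of_nonneg_of_le_pi h0 (by linarith [Real.pi_pos]))]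

/-- All the square roots involved are at most `1`. [folklore] -/
theorem mS_le_one (u : ℝ) : mS(u) ≤ 1 :=
  Real.sqrt_le_one.2 (by linarith [le_max_left (u ^ 2) ((1 - u) ^ 2), sq_nonneg u])

/-- `c ≤ 1`. [folklore] -/
theorem cT_le_one (u v : ℝ) : cT(u,v) ≤ 1 := Real.sqrt_le_one.2 (by nlinarith)

/-- The symmetrised split of the integrand: `(m + m' − c)₊² = R₁ + R₂`. [folklore] -/
theorem sq_posPart_eq (u v : ℝ) :
    (max (mS(u) + mS(v) - cT(u,v)) 0) ^ 2 = R1t(u,v) + R2t(u,v) := by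
  by_cases h : cT(u,v) ≤ mS(u) + mS(v)
  · rw [if_pos h, if_pos h, max_eq_left (by linarith)]; ring
  · rw [if_neg h, if_neg h, max_eq_right (by linarith)]; ring

/-- `R₂` is antisymmetric under `(u, u') ↦ (u', u)`. [folklore] -/
theorem R2t_swap (u v : ℝ) : R2t(v,u) = -R2t(u,v) := by
  have hc : cT(v,u) = cT(u,v) := by rw [show (v - u) ^ 2 = (u - v) ^ 2 by ring]
  rw [hc]
  by_cases h : cT(u,v) ≤ mS(u) + mS(v)
  · rw [if_pos h, if_pos (by linarith)]; ring
  · rw [if_neg h, if_neg (by linarith)]; ring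

/-- `R₁` is invariant under `(u, u') ↦ (1 − u, 1 − u')`. [folklore] -/
theorem R1t_one_sub (u v : ℝ) : R1t(1 - u, 1 - v) = R1t(u,v) := by
  have hc : cT(1 - u, 1 - v) = cT(u,v) := by rw [show ((1 - u) - (1 - v)) ^ 2 = (u - v) ^ 2 by ring]
  rw [hc, mS_one_sub, mS_one_sub]

/-! ### Measurability and integrability -/

/-- `R₁` is measurable. [folklore] -/
theorem measurable_R1t : Measurable fun z : ℝ × ℝ => R1t(z.1, z.2) := by
  have h1 : Measurable fun z : ℝ × ℝ => mS(z.1) := continuous_mS.measurable.comp measurable_fst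
  have h2 : Measurable fun z : ℝ × ℝ => mS(z.2) := continuous_mS.measurable.comp measurable_snd
  have h3 : Measurable fun z : ℝ × ℝ => cT(z.1, z.2) :=
    (Real.continuous_sqrt.comp (by fun_prop)).measurable
  refine Measurable.ite (measurableSet_le h3 (h1.add h2)) ?_ measurable_const
  exact ((((h1.pow_const 2).const_mul 2).add (h3.pow_const 2)).add ((h1.const_mul 2).mul h2)).sub
    ((h1.const_mul 4).mul h3)

/-- `R₂` is measurable. [folklore] -/
theorem measurable_R2t : Measurable fun z : ℝ × ℝ => R2t(z.1, z.2) := by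
  have h1 : Measurable fun z : ℝ × ℝ => mS(z.1) := continuous_mS.measurable.comp measurable_fst
  have h2 : Measurable fun z : ℝ × ℝ => mS(z.2) := continuous_mS.measurable.comp measurable_snd
  have h3 : Measurable fun z : ℝ × ℝ => cT(z.1, z.2) :=
    (Real.continuous_sqrt.comp (by fun_prop)).measurable
  refine Measurable.ite (measurableSet_le h3 (h1.add h2)) ?_ measurable_const
  exact ((h2.pow_const 2).sub (h1.pow_const 2)).sub (((h2.sub h1).const_mul 2).mul h3)

/-- The unit square has Lebesgue measure `1`. [folklore] -/
theorem volume_unitSq : volume (Ioo (0:ℝ) 1 ×ˢ Ioo (0:ℝ) 1) = 1 := by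
  rw [Measure.volume_eq_prod, Measure.prod_prod, Real.volume_Ioo]; norm_num

/-- `R₁` is integrable on the unit square (bounded by `9`). [folklore] -/
theorem integrableOn_R1t : IntegrableOn (fun z : ℝ × ℝ => R1t(z.1, z.2))
    (Ioo (0:ℝ) 1 ×ˢ Ioo (0:ℝ) 1) volume := by
  refine Measure.integrableOn_of_bounded (M := 9) (by rw [volume_unitSq]; exact ENNReal.one_ne_top)
    measurable_R1t.aestronglyMeasurable (ae_of_all _ fun z => ?_)
  rw [Real.norm_eq_abs]
  have h1 := mS_le_one z.1; have h2 := mS_le_one z.2; have h3 := cT_le_one z.1 z.2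
  have h1' := Real.sqrt_nonneg (1 - max (z.1 ^ 2) ((1 - z.1) ^ 2))
  have h2' := Real.sqrt_nonneg (1 - max (z.2 ^ 2) ((1 - z.2) ^ 2))
  have h3' := Real.sqrt_nonneg (1 - (z.1 - z.2) ^ 2)
  split_ifs
  · rw [abs_le]; constructor <;> nlinarith [mul_nonneg h1' h2', mul_nonneg h1' h3']
  · simp

/-- `R₂` is integrable on the unit square (bounded by `5`). [folklore] -/
theorem integrableOn_R2t : IntegrableOn (fun z : ℝ × ℝ => R2t(z.1, z.2))
    (Ioo (0:ℝ) 1 ×ˢ Ioo (0:ℝ) 1) volume := by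
  refine Measure.integrableOn_of_bounded (M := 5) (by rw [volume_unitSq]; exact ENNReal.one_ne_top)
    measurable_R2t.aestronglyMeasurable (ae_of_all _ fun z => ?_)
  rw [Real.norm_eq_abs]
  have h1 := mS_le_one z.1; have h2 := mS_le_one z.2; have h3 := cT_le_one z.1 z.2
  have h1' := Real.sqrt_nonneg (1 - max (z.1 ^ 2) ((1 - z.1) ^ 2))
  have h2' := Real.sqrt_nonneg (1 - max (z.2 ^ 2) ((1 - z.2) ^ 2))
  have h3' := Real.sqrt_nonneg (1 - (z.1 - z.2) ^ 2)
  split_ifs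
  · rw [abs_le]; constructor <;> nlinarith [mul_nonneg h1' h3', mul_nonneg h2' h3']
  · simp

/-- An integrable function antisymmetric under the swap of a square's coordinates integrates
to zero. [folklore] -/
theorem setIntegral_sq_eq_zero_of_swap {f : ℝ × ℝ → ℝ} (hf : ∀ z : ℝ × ℝ, f z.swap = -f z)
    (s : Set ℝ) : ∫ z in s ×ˢ s, f z = 0 := by
  have h := integral_prod_swap (μ := volume.restrict s) (ν := volume.restrict s) f
  rw [Measure.prod_restrict, ← Measure.volume_eq_prod] at h
  have h2 : ∫ z in s ×ˢ s, f z.swap = -∫ z in s ×ˢ s, f z := by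
    rw [← integral_neg]
    exact integral_congr_ae (ae_of_all _ fun z => hf z)
  linarith

/-! ### The region `Ω = {c ≤ m + m'}` along a vertical line `u = 1 − cos A` -/

/-- For `u = 1 − cos A`, `A ∈ (0, π/3)`, and `u' ∈ (0,1)`: `c ≤ m + m' ↔ 1 − cos(π/3 − A) ≤ u'`.
[folklore] -/
theorem omega_iff {A u' : ℝ} (hA : A ∈ Ioo 0 (π / 3)) (hu' : u' ∈ Ioo (0:ℝ) 1) :
    cT(1 - Real.cos A, u') ≤ mS(1 - Real.cos A) + mS(u') ↔ 1 - Real.cos (π / 3 - A) ≤ u' := by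
  have hπ := Real.pi_pos
  have hmA : mS(1 - Real.cos A) = Real.sin A := mS_one_sub_cos hA.1.le hA.2.le
  have hsA : 0 < Real.sin A := Real.sin_pos_of_pos_of_lt_pi hA.1 (by linarith [hA.2])
  have hcosB : 1 / 2 ≤ Real.cos (π / 3 - A) := by
    rw [← Real.cos_pi_div_three]
    exact Real.cos_le_cos_of_nonneg_of_le_pi (by linarith [hA.2]) (by linarith) (by linarith [hA.1])
  rw [hmA]
  rcases le_or_gt u' (1 / 2) with hu | hu
  · -- u' ≤ 1/2 : trigonometric parametrisation u' = 1 - cos A'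
    set A' := Real.arccos (1 - u') with hA'
    have hcA' : Real.cos A' = 1 - u' := Real.cos_arccos (by linarith [hu'.2]) (by linarith [hu'.1])
    have hA'0 : 0 ≤ A' := Real.arccos_nonneg _
    have hA'π : A' ≤ π := Real.arccos_le_pi _
    have hsA' : Real.sin A' = mS(u') := by
      rw [hA', Real.sin_arccos, mS_of_le_half hu]
    have hA'le : A' ≤ π / 3 := by
      have h := Real.arccos_le_arccos (show (1:ℝ) / 2 ≤ 1 - u' by linarith)
      rwa [show Real.arccos (1 / 2) = π / 3 by
        rw [← Real.cos_pi_div_three, Real.arccos_cos (by linarith) (by linarith)]] at h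
    rw [← hsA']
    have hcT : cT(1 - Real.cos A, u') = Real.sqrt (1 - (Real.cos A' - Real.cos A) ^ 2) := by
      rw [hcA']; congr 2; ring
    rw [hcT]
    have hnn : 0 ≤ Real.sin A + Real.sin A' := by
      have := Real.sin_nonneg_of_nonneg_of_le_pi hA'0 hA'π; linarith
    have key : (Real.sin A + Real.sin A') ^ 2 - (1 - (Real.cos A' - Real.cos A) ^ 2) =
        1 - 2 * Real.cos (A + A') := by
      rw [Real.cos_add]
      linear_combination Real.sin_sq_add_cos_sq A + Real.sin_sq_add_cos_sq A'
    have h1 : Real.sqrt (1 - (Real.cos A' - Real.cos A) ^ 2) ≤ Real.sin A + Real.sin A' ↔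
        Real.cos (A + A') ≤ 1 / 2 := by
      rw [Real.sqrt_le_left hnn]
      constructor <;> intro h <;> nlinarith [key]
    rw [h1]
    have h2 : Real.cos (A + A') ≤ 1 / 2 ↔ π / 3 ≤ A + A' := by
      rw [← Real.cos_pi_div_three]
      exact Real.strictAntiOn_cos.le_iff_ge ⟨by linarith [hA.1], by linarith [hA.2]⟩
        ⟨by linarith, by linarith⟩
    rw [h2]
    have h3 : π / 3 ≤ A + A' ↔ Real.cos A' ≤ Real.cos (π / 3 - A) := by
      rw [Real.strictAntiOn_cos.le_iff_ge ⟨hA'0, hA'π⟩ ⟨by linarith [hA.2], by linarith [hA.1]⟩]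
      constructor <;> intro h <;> linarith
    rw [h3, hcA']
    constructor <;> intro h <;> linarith
  · -- 1/2 < u' : always in Ω
    have hm' : mS(u') = Real.sqrt (1 - u' ^ 2) := mS_of_half_le hu.le
    rw [hm']
    have hm'0 : 0 ≤ Real.sqrt (1 - u' ^ 2) := Real.sqrt_nonneg _
    have hm'sq : Real.sqrt (1 - u' ^ 2) ^ 2 = 1 - u' ^ 2 := Real.sq_sqrt (by nlinarith [hu'.2])
    have hcA : Real.cos A ≤ 1 := Real.cos_le_one A
    constructor
    · intro _; linarith
    · intro _
      rw [Real.sqrt_le_left (by linarith)]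
      nlinarith [mul_nonneg hsA.le hm'0, mul_nonneg (sub_nonneg.2 hcA) (sub_nonneg.2 hu'.2.le),
        Real.sin_sq_add_cos_sq A, hm'sq]


/-! ### The inner integral in closed form -/

/-- `∫_{u₀}^{1} m(u') du' = (F(cos(π/3−A)) − F(1/2)) + (F(1) − F(1/2))` with `u₀ = 1 − cos(π/3−A)`,
`F(x) = (x√(1−x²) + arcsin x)/2`, split at `u' = 1/2`. [folklore] -/
theorem integral_mS {A : ℝ} (hA : A ∈ Ioo 0 (π / 3)) :
    ∫ u' in (1 - Real.cos (π / 3 - A))..1, mS(u') =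
      ((Real.cos (π / 3 - A) * Real.sin (π / 3 - A) + (π / 6 + A)) / 2
        - ((1 / 2) * (Real.sqrt 3 / 2) + π / 6) / 2)
      + (π / 4 - ((1 / 2) * (Real.sqrt 3 / 2) + π / 6) / 2) := by
  have hπ := Real.pi_pos
  have hcosB : 1 / 2 ≤ Real.cos (π / 3 - A) := by
    rw [← Real.cos_pi_div_three]
    exact Real.cos_le_cos_of_nonneg_of_le_pi (by linarith [hA.2]) (by linarith) (by linarith [hA.1])
  have hcosB1 : Real.cos (π / 3 - A) ≤ 1 := Real.cos_le_one _
  rw [← intervalIntegral.integral_add_adjacent_intervals (b := 1 / 2)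
    (continuous_mS.intervalIntegrable _ _) (continuous_mS.intervalIntegrable _ _)]
  have hL : ∫ u' in (1 - Real.cos (π / 3 - A))..(1 / 2), mS(u') =
      ∫ u' in (1 - Real.cos (π / 3 - A))..(1 / 2), Real.sqrt (1 - (1 - u') ^ 2) := by
    apply intervalIntegral.integral_congr
    intro u' hu'
    rw [uIcc_of_le (by linarith)] at hu'
    exact mS_of_le_half hu'.2
  have hR : ∫ u' in (1 / 2 : ℝ)..1, mS(u') = ∫ u' in (1 / 2 : ℝ)..1, Real.sqrt (1 - u' ^ 2) := by
    apply intervalIntegral.integral_congr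
    intro u' hu'
    rw [uIcc_of_le (by norm_num)] at hu'
    exact mS_of_half_le hu'.1
  rw [hL, hR, intervalIntegral.integral_comp_sub_left (fun x => Real.sqrt (1 - x ^ 2)) 1,
    show (1 : ℝ) - 1 / 2 = 1 / 2 by norm_num, show 1 - (1 - Real.cos (π / 3 - A)) =
      Real.cos (π / 3 - A) by ring,
    integral_sqrt_one_sub_sq' (by norm_num) hcosB hcosB1,
    integral_sqrt_one_sub_sq' (by norm_num) (by norm_num) le_rfl]
  have hs1 : Real.sqrt (1 - Real.cos (π / 3 - A) ^ 2) = Real.sin (π / 3 - A) := by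
    rw [← Real.sin_sq, Real.sqrt_sq (Real.sin_nonneg_of_nonneg_of_le_pi (by linarith [hA.2])
      (by linarith [hA.1]))]
  have hs2 : Real.arcsin (Real.cos (π / 3 - A)) = π / 6 + A := by
    rw [← Real.sin_pi_div_two_sub, Real.arcsin_sin (by linarith [hA.1]) (by linarith [hA.2])]; ring
  have hs3 : Real.sqrt (1 - (1 / 2 : ℝ) ^ 2) = Real.sqrt 3 / 2 := by
    rw [show (1:ℝ) - (1 / 2) ^ 2 = (Real.sqrt 3 / 2) ^ 2 by
      rw [div_pow (Real.sqrt 3), Real.sq_sqrt (by norm_num : (0:ℝ) ≤ 3)]; norm_num]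
    exact Real.sqrt_sq (by positivity)
  have hs4 : Real.arcsin (1 / 2 : ℝ) = π / 6 := by
    rw [← Real.sin_pi_div_six]; exact Real.arcsin_sin (by linarith) (by linarith)
  simp only [hs1, hs2, hs3, hs4, one_pow, sub_self, Real.sqrt_zero, mul_zero, zero_add,
    Real.arcsin_one]
  all_goals ring

/-- `∫_{u₀}^{1} c(u,u') du' = F(cos A) − F(sin(π/6 − A))` for `u = 1 − cos A`. [folklore] -/
theorem integral_cT {A : ℝ} (hA : A ∈ Ioo 0 (π / 3)) :
    ∫ u' in (1 - Real.cos (π / 3 - A))..1, cT(1 - Real.cos A, u') =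
      (Real.cos A * Real.sin A + (π / 2 - A)) / 2
        - (Real.sin (π / 6 - A) * Real.cos (π / 6 - A) + (π / 6 - A)) / 2 := by
  have hπ := Real.pi_pos
  have hd : (1 - Real.cos (π / 3 - A)) - (1 - Real.cos A) = Real.sin (π / 6 - A) := by
    rw [Real.cos_sub, Real.sin_sub, Real.cos_pi_div_three, Real.sin_pi_div_three,
      Real.sin_pi_div_six, Real.cos_pi_div_six]; ring
  have h1 : ∫ u' in (1 - Real.cos (π / 3 - A))..1, cT(1 - Real.cos A, u') =
      ∫ u' in (1 - Real.cos (π / 3 - A))..1, Real.sqrt (1 - (u' - (1 - Real.cos A)) ^ 2) := by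
    apply intervalIntegral.integral_congr
    intro u' _
    simp only
    rw [show ((1 - Real.cos A) - u') ^ 2 = (u' - (1 - Real.cos A)) ^ 2 by ring]
  rw [h1, intervalIntegral.integral_comp_sub_right (fun x => Real.sqrt (1 - x ^ 2)), hd,
    show 1 - (1 - Real.cos A) = Real.cos A by ring]
  have hsin6 : -(1 / 2) ≤ Real.sin (π / 6 - A) ∧ Real.sin (π / 6 - A) ≤ 1 / 2 := by
    rw [← Real.sin_pi_div_six, ← Real.sin_neg]
    have hm : -(π / 6) ≤ π / 6 - A := by linarith [hA.2]
    have hp : π / 6 - A ≤ π / 6 := by linarith [hA.1]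
    exact ⟨Real.sin_le_sin_of_le_of_le_pi_div_two (by linarith) (by linarith) hm,
      Real.sin_le_sin_of_le_of_le_pi_div_two (by linarith) (by linarith) hp⟩
  have hcosA : 1 / 2 < Real.cos A := by
    rw [← Real.cos_pi_div_three]
    exact Real.cos_lt_cos_of_nonneg_of_le_pi hA.1.le (by linarith) hA.2
  rw [integral_sqrt_one_sub_sq' (by linarith [hsin6.1]) (by linarith [hsin6.2]) (Real.cos_le_one A)]
  have e1 : Real.sqrt (1 - Real.cos A ^ 2) = Real.sin A := by
    rw [← Real.sin_sq,
      Real.sqrt_sq (Real.sin_nonneg_of_nonneg_of_le_pi hA.1.le (by linarith [hA.2]))]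
  have e2 : Real.arcsin (Real.cos A) = π / 2 - A := by
    rw [← Real.sin_pi_div_two_sub, Real.arcsin_sin (by linarith [hA.2]) (by linarith [hA.1])]
  have e3 : Real.sqrt (1 - Real.sin (π / 6 - A) ^ 2) = Real.cos (π / 6 - A) := by
    rw [← Real.cos_sq',
      Real.sqrt_sq (Real.cos_nonneg_of_mem_Icc ⟨by linarith [hA.2], by linarith [hA.1]⟩)]
  have e4 : Real.arcsin (Real.sin (π / 6 - A)) = π / 6 - A :=
    Real.arcsin_sin (by linarith [hA.2]) (by linarith [hA.1])
  rw [e1, e2, e3, e4]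

/-- **The inner integral.** For `A ∈ (0, π/3)`:
`∫_{u' ∈ (0,1)} R₁(1 − cos A, u') du' = kA(A)`. [folklore] -/
theorem inner_integral_R1t {A : ℝ} (hA : A ∈ Ioo 0 (π / 3)) :
    ∫ u' in Ioo (0:ℝ) 1, R1t(1 - Real.cos A, u') = kA(A) := by
  have hπ := Real.pi_pos
  set u₀ := 1 - Real.cos (π / 3 - A) with hu₀
  have hcosB : 1 / 2 < Real.cos (π / 3 - A) := by
    rw [← Real.cos_pi_div_three]
    exact Real.cos_lt_cos_of_nonneg_of_le_pi (by linarith [hA.2]) (by linarith) (by linarith [hA.1])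
  have hcosB1 : Real.cos (π / 3 - A) < 1 := by
    rw [← Real.cos_zero]
    exact Real.cos_lt_cos_of_nonneg_of_le_pi le_rfl (by linarith [hA.1]) (by linarith [hA.2])
  have hu₀0 : 0 < u₀ := by rw [hu₀]; linarith
  have hu₀1 : u₀ < 1 := by rw [hu₀]; linarith
  have hmA : mS(1 - Real.cos A) = Real.sin A := mS_one_sub_cos hA.1.le hA.2.le
  -- Step 1: restrict to `[u₀, 1)`
  have h1 : ∫ u' in Ioo (0:ℝ) 1, R1t(1 - Real.cos A, u') =
      ∫ u' in Ioo (0:ℝ) 1, (Ici u₀).indicator (fun u' => J2(1 - Real.cos A, u')) u' := by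
    refine setIntegral_congr_fun measurableSet_Ioo fun u' hu' => ?_
    by_cases h : u₀ ≤ u'
    · rw [indicator_of_mem (mem_Ici.2 h), if_pos ((omega_iff hA hu').2 h)]
    · rw [indicator_of_notMem (fun h' => h (mem_Ici.1 h')),
        if_neg (fun h' => h ((omega_iff hA hu').1 h'))]
  rw [h1, setIntegral_indicator measurableSet_Ici,
    show Ioo (0:ℝ) 1 ∩ Ici u₀ = Ico u₀ 1 from by
      ext x; simp only [mem_inter_iff, mem_Ioo, mem_Ici, mem_Ico]
      constructor
      · rintro ⟨⟨_, h2⟩, h3⟩; exact ⟨h3, h2⟩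
      · rintro ⟨h1, h2⟩; exact ⟨⟨by linarith, h2⟩, h1⟩,
    integral_Ico_eq_integral_Ioo, ← integral_Ioc_eq_integral_Ioo,
    ← intervalIntegral.integral_of_le hu₀1.le]
  -- Step 2: linearity
  have hc1 : Continuous fun u' : ℝ => cT(1 - Real.cos A, u') :=
    Real.continuous_sqrt.comp (by fun_prop)
  have hI1 : IntervalIntegrable (fun _ : ℝ => 2 * Real.sin A ^ 2) volume u₀ 1 :=
    intervalIntegrable_const
  have hI2 : IntervalIntegrable (fun u' : ℝ => cT(1 - Real.cos A, u') ^ 2) volume u₀ 1 :=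
    (hc1.pow 2).intervalIntegrable _ _
  have hI3 : IntervalIntegrable (fun u' : ℝ => 2 * Real.sin A * mS(u')) volume u₀ 1 :=
    (continuous_const.mul continuous_mS).intervalIntegrable _ _
  have hI4 :
      IntervalIntegrable (fun u' : ℝ => 4 * Real.sin A * cT(1 - Real.cos A, u')) volume u₀ 1 :=
    (continuous_const.mul hc1).intervalIntegrable _ _
  have hsplit : ∫ u' in u₀..1, J2(1 - Real.cos A, u') =
      (∫ u' in u₀..1, (2 * Real.sin A ^ 2 : ℝ)) + (∫ u' in u₀..1, cT(1 - Real.cos A, u') ^ 2) +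
      (∫ u' in u₀..1, 2 * Real.sin A * mS(u')) -
      (∫ u' in u₀..1, 4 * Real.sin A * cT(1 - Real.cos A, u')) := by
    rw [← intervalIntegral.integral_add hI1 hI2, ← intervalIntegral.integral_add (hI1.add hI2) hI3,
      ← intervalIntegral.integral_sub ((hI1.add hI2).add hI3) hI4]
    apply intervalIntegral.integral_congr
    intro u' _
    simp only [hmA]
  rw [hsplit]
  -- Step 3: the four pieces
  have hT1 : ∫ u' in u₀..1, (2 * Real.sin A ^ 2 : ℝ) = (1 - u₀) * (2 * Real.sin A ^ 2) := by
    rw [intervalIntegral.integral_const, smul_eq_mul]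
  have hd : u₀ - (1 - Real.cos A) = Real.sin (π / 6 - A) := by
    rw [hu₀, Real.cos_sub, Real.sin_sub, Real.cos_pi_div_three, Real.sin_pi_div_three,
      Real.sin_pi_div_six, Real.cos_pi_div_six]; ring
  have hT2 : ∫ u' in u₀..1, cT(1 - Real.cos A, u') ^ 2 =
      (Real.cos A - Real.sin (π / 6 - A)) - (Real.cos A ^ 3 - Real.sin (π / 6 - A) ^ 3) / 3 := by
    have h2 : ∫ u' in u₀..1, cT(1 - Real.cos A, u') ^ 2 =
        ∫ u' in u₀..1, (1 - (u' - (1 - Real.cos A)) ^ 2) := by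
      apply intervalIntegral.integral_congr
      intro u' hu'
      rw [uIcc_of_le hu₀1.le] at hu'
      have hcA := Real.cos_le_one A
      have hcA' : 0 ≤ Real.cos A := by linarith [Real.cos_pi_div_three ▸
        Real.cos_le_cos_of_nonneg_of_le_pi hA.1.le (by linarith) hA.2.le]
      simp only
      rw [Real.sq_sqrt (by nlinarith [hu'.1, hu'.2]), show ((1 - Real.cos A) - u') ^ 2 =
        (u' - (1 - Real.cos A)) ^ 2 by ring]
    rw [h2, intervalIntegral.integral_comp_sub_right (fun x => 1 - x ^ 2), hd,
      show 1 - (1 - Real.cos A) = Real.cos A by ring,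
      intervalIntegral.integral_sub intervalIntegrable_const
        (intervalIntegral.intervalIntegrable_pow 2),
      intervalIntegral.integral_const, integral_pow, smul_eq_mul]
    ring
  have hT3 : ∫ u' in u₀..1, 2 * Real.sin A * mS(u') = 2 * Real.sin A *
      (((Real.cos (π / 3 - A) * Real.sin (π / 3 - A) + (π / 6 + A)) / 2
        - ((1 / 2) * (Real.sqrt 3 / 2) + π / 6) / 2)
      + (π / 4 - ((1 / 2) * (Real.sqrt 3 / 2) + π / 6) / 2)) := by
    rw [intervalIntegral.integral_const_mul, integral_mS hA]
  have hT4 : ∫ u' in u₀..1, 4 * Real.sin A * cT(1 - Real.cos A, u') = 4 * Real.sin A *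
      ((Real.cos A * Real.sin A + (π / 2 - A)) / 2
        - (Real.sin (π / 6 - A) * Real.cos (π / 6 - A) + (π / 6 - A)) / 2) := by
    rw [intervalIntegral.integral_const_mul, integral_cT hA]
  rw [hT1, hT2, hT3, hT4]

/-- The bridging identity `sin A · kA(A) = Tpoly(A)` (addition formulas; a polynomial identity in
`sin A, cos A, √3, π, A` modulo `sin² + cos² = 1`, `(√3)² = 3`). [folklore] -/
theorem sin_mul_kA (A : ℝ) : Real.sin A * kA(A) = Tpoly(A) := by
  have h3 : Real.sqrt 3 ^ 2 = 3 := Real.sq_sqrt (by norm_num)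
  simp only [Real.cos_sub, Real.sin_sub, Real.cos_pi_div_three, Real.sin_pi_div_three,
    Real.sin_pi_div_six, Real.cos_pi_div_six]
  linear_combination ((-1/3:ℝ)*π + (1/4:ℝ)*Real.sqrt 3 + (-1/24:ℝ)*Real.sqrt 3^3 +
    (3/8:ℝ)*Real.sqrt 3*Real.cos A^2 + (1/24:ℝ)*Real.sqrt 3^3*Real.cos A^2 +
    (-3/4:ℝ)*Real.sin A*Real.cos A + (-1/8:ℝ)*Real.sqrt 3^2*Real.sin A*Real.cos A +
    (1/4:ℝ)*Real.sqrt 3*Real.sin A^2 + (-1/24:ℝ)*Real.sqrt 3^3*Real.sin A^2 + (1:ℝ)*A) *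
    Real.sin_sq_add_cos_sq A + ((-1/24:ℝ)*Real.sqrt 3 + (1/12:ℝ)*Real.sqrt 3*Real.cos A^2 +
    (-1/24:ℝ)*Real.sqrt 3*Real.cos A^4 + (-1/8:ℝ)*Real.sin A*Real.cos A +
    (1/8:ℝ)*Real.sin A*Real.cos A^3) * h3

/-- An antiderivative of the outer integrand `T(A)`. [folklore] -/
theorem hasDerivAt_psiPrim (A : ℝ) :
    HasDerivAt (fun A : ℝ =>
      ((1/16:ℝ)) * (A ^ 0 * Real.sin A ^ 0 * Real.cos A ^ 2) +
        ((-5/24:ℝ)) * (A ^ 0 * Real.sin A ^ 0 * Real.cos A ^ 4) +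
        ((1/6:ℝ)*π) * (A ^ 0 * Real.sin A ^ 1 * Real.cos A ^ 1) +
        ((-1/8:ℝ)*Real.sqrt 3) * (A ^ 0 * Real.sin A ^ 1 * Real.cos A ^ 3) +
        ((-1/6:ℝ)*π + (1/8:ℝ)*Real.sqrt 3) * (A ^ 1 * Real.sin A ^ 0 * Real.cos A ^ 0) +
        ((-1/2:ℝ)) * (A ^ 1 * Real.sin A ^ 1 * Real.cos A ^ 1) +
        ((1/4:ℝ)) * (A ^ 2 * Real.sin A ^ 0 * Real.cos A ^ 0))
      (Tpoly(A)) A := by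
  have h0 := (hasDerivAt_monomial 0 0 2 A).const_mul ((1/16:ℝ))
  have h1 := h0.fun_add
    ((hasDerivAt_monomial 0 0 4 A).const_mul ((-5/24:ℝ)))
  have h2 := h1.fun_add
    ((hasDerivAt_monomial 0 1 1 A).const_mul ((1/6:ℝ)*π))
  have h3 := h2.fun_add
    ((hasDerivAt_monomial 0 1 3 A).const_mul ((-1/8:ℝ)*Real.sqrt 3))
  have h4 := h3.fun_add
    ((hasDerivAt_monomial 1 0 0 A).const_mul ((-1/6:ℝ)*π + (1/8:ℝ)*Real.sqrt 3))
  have h5 := h4.fun_add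
    ((hasDerivAt_monomial 1 1 1 A).const_mul ((-1/2:ℝ)))
  have h6 := h5.fun_add
    ((hasDerivAt_monomial 2 0 0 A).const_mul ((1/4:ℝ)))
  refine h6.congr_deriv ?_
  linear_combination ((-1/6:ℝ)*π + (3/8:ℝ)*Real.sqrt 3*Real.cos A^2 + (1/2:ℝ)*A) *
    Real.sin_sq_add_cos_sq A


/-- `∫₀^{π/3} Tpoly = 1/8 − π²/36 + √3π/24`. [folklore] -/
theorem integral_Tpoly :
    ∫ A in (0:ℝ)..(π / 3), Tpoly(A) = 1 / 8 - π ^ 2 / 36 + Real.sqrt 3 * π / 24 := by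
  rw [intervalIntegral.integral_eq_sub_of_hasDerivAt (fun A _ => hasDerivAt_psiPrim A)
    ((by fun_prop : Continuous fun A : ℝ => Tpoly(A)).intervalIntegrable _ _)]
  simp only [Real.sin_pi_div_three, Real.cos_pi_div_three, Real.sin_zero, Real.cos_zero]
  have h3 : Real.sqrt 3 ^ 2 = 3 := Real.sq_sqrt (by norm_num)
  linear_combination (-1 / 128 : ℝ) * h3

/-! ### The outer integral: symmetry `u ↦ 1 − u` and the substitution `u = 1 − cos A` -/

/-- `1 − cos` maps `(0, π/3)` onto `(0, 1/2)`. [folklore] -/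
theorem image_one_sub_cos : (fun A : ℝ => 1 - Real.cos A) '' Ioo 0 (π / 3) = Ioo 0 (1 / 2) := by
  have hπ := Real.pi_pos
  ext y
  simp only [mem_image, mem_Ioo]
  constructor
  · rintro ⟨A, ⟨hA0, hA1⟩, rfl⟩
    have h1 : Real.cos A < 1 := by
      rw [← Real.cos_zero]
      exact Real.cos_lt_cos_of_nonneg_of_le_pi le_rfl (by linarith) hA0
    have h2 : 1 / 2 < Real.cos A := by
      rw [← Real.cos_pi_div_three]
      exact Real.cos_lt_cos_of_nonneg_of_le_pi hA0.le (by linarith) hA1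
    constructor <;> linarith
  · rintro ⟨hy0, hy1⟩
    refine ⟨Real.arccos (1 - y), ⟨Real.arccos_pos.2 (by linarith), ?_⟩, ?_⟩
    · have : Real.arccos (1 - y) < Real.arccos (1 / 2) :=
        Real.arccos_lt_arccos (by norm_num) (by linarith) (by linarith)
      rwa [show Real.arccos (1 / 2) = π / 3 by
        rw [← Real.cos_pi_div_three, Real.arccos_cos (by linarith) (by linarith)]] at this
    · simp only [Real.cos_arccos (by linarith : (-1:ℝ) ≤ 1 - y) (by linarith)]; ring

/-- **The value of `Ψ`.** `∫∫_{(0,1)²} (m(u) + m(u') − c)₊² du du' = 1/4 − π²/18 + √3π/12`.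
[folklore] -/
theorem integral_sq_posPart :
    ∫ z in Ioo (0:ℝ) 1 ×ˢ Ioo (0:ℝ) 1, (max (mS(z.1) + mS(z.2) - cT(z.1, z.2)) 0) ^ 2 =
      1 / 4 - π ^ 2 / 18 + Real.sqrt 3 * π / 12 := by
  have hπ := Real.pi_pos
  -- symmetrisation
  have hsplit : ∫ z in Ioo (0:ℝ) 1 ×ˢ Ioo (0:ℝ) 1, (max (mS(z.1) + mS(z.2) - cT(z.1, z.2)) 0) ^ 2 =
      ∫ z in Ioo (0:ℝ) 1 ×ˢ Ioo (0:ℝ) 1, R1t(z.1, z.2) := by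
    have h := integral_add integrableOn_R1t integrableOn_R2t
    rw [setIntegral_sq_eq_zero_of_swap (f := fun z : ℝ × ℝ => R2t(z.1, z.2))
      (fun z => R2t_swap z.1 z.2) (Ioo (0:ℝ) 1), add_zero] at h
    rw [← h]
    exact integral_congr_ae (ae_of_all _ fun z => sq_posPart_eq z.1 z.2)
  rw [hsplit]
  -- Fubini
  have hprod : (volume : Measure (ℝ × ℝ)).restrict (Ioo (0:ℝ) 1 ×ˢ Ioo (0:ℝ) 1) =
      (volume.restrict (Ioo (0:ℝ) 1)).prod (volume.restrict (Ioo (0:ℝ) 1)) := by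
    rw [Measure.volume_eq_prod, Measure.prod_restrict]
  have hint : Integrable (fun z : ℝ × ℝ => R1t(z.1, z.2))
      ((volume.restrict (Ioo (0:ℝ) 1)).prod (volume.restrict (Ioo (0:ℝ) 1))) := by
    rw [← hprod]; exact integrableOn_R1t
  rw [hprod, integral_prod _ hint]
  simp only
  -- the inner integrals `K u`
  set K : ℝ → ℝ := fun u => ∫ u' in Ioo (0:ℝ) 1, R1t(u, u') with hK
  have hKint : IntegrableOn K (Ioo (0:ℝ) 1) volume := hint.integral_prod_left
  have hKsym : ∀ u, K (1 - u) = K u := by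
    intro u
    simp only [hK]
    have hmp : MeasurePreserving (fun t : ℝ => 1 - t) volume volume :=
      Measure.measurePreserving_sub_left volume 1
    have hemb : MeasurableEmbedding (fun t : ℝ => 1 - t) :=
      (MeasurableEquiv.subLeft (1:ℝ)).measurableEmbedding
    have key := hmp.setIntegral_preimage_emb hemb (fun y => R1t(1 - u, y)) (Ioo (0:ℝ) 1)
    have hpre : (fun t : ℝ => 1 - t) ⁻¹' Ioo (0:ℝ) 1 = Ioo 0 1 := by
      ext t; simp only [mem_preimage, mem_Ioo]; constructor <;> intro h <;> constructor <;> linarith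
    rw [hpre] at key
    rw [← key]
    refine setIntegral_congr_fun measurableSet_Ioo fun y _ => ?_
    exact R1t_one_sub u y
  -- ∫₀¹ K = 2 ∫₀^{1/2} K
  change ∫ u in Ioo (0:ℝ) 1, K u = _
  have hunion : Ioo (0:ℝ) 1 = Ioc 0 (1 / 2) ∪ Ioo (1 / 2) 1 :=
    (Ioc_union_Ioo_eq_Ioo (by norm_num) (by norm_num)).symm
  have hdisj : Disjoint (Ioc (0:ℝ) (1 / 2)) (Ioo (1 / 2) 1) :=
    disjoint_left.2 fun x h1 h2 => by linarith [h1.2, h2.1]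
  have hK1 : IntegrableOn K (Ioc 0 (1 / 2)) volume :=
    hKint.mono_set fun x hx => ⟨hx.1, by linarith [hx.2]⟩
  have hK2 : IntegrableOn K (Ioo (1 / 2) 1) volume :=
    hKint.mono_set fun x hx => ⟨by linarith [hx.1], hx.2⟩
  rw [hunion, setIntegral_union hdisj measurableSet_Ioo hK1 hK2]
  have hsecond : ∫ u in Ioo (1 / 2 : ℝ) 1, K u = ∫ u in Ioo (0:ℝ) (1 / 2), K u := by
    have hmp : MeasurePreserving (fun t : ℝ => 1 - t) volume volume :=
      Measure.measurePreserving_sub_left volume 1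
    have hemb : MeasurableEmbedding (fun t : ℝ => 1 - t) :=
      (MeasurableEquiv.subLeft (1:ℝ)).measurableEmbedding
    have key := hmp.setIntegral_preimage_emb hemb K (Ioo (0:ℝ) (1 / 2))
    have hpre : (fun t : ℝ => 1 - t) ⁻¹' Ioo (0:ℝ) (1 / 2) = Ioo (1 / 2) 1 := by
      ext t; simp only [mem_preimage, mem_Ioo]; constructor <;> intro h <;> constructor <;> linarith
    rw [hpre] at key
    rw [← key]
    exact setIntegral_congr_fun measurableSet_Ioo fun u _ => (hKsym u).symm
  rw [setIntegral_congr_set (Ioo_ae_eq_Ioc : Ioo (0:ℝ) (1 / 2) =ᵐ[volume] Ioc 0 (1 / 2)).symm,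
    hsecond, ← two_mul]
  -- substitution u = 1 - cos A
  have hinj : InjOn (fun A : ℝ => 1 - Real.cos A) (Ioo 0 (π / 3)) := by
    intro x hx y hy hxy
    simp only at hxy
    exact Real.injOn_cos ⟨hx.1.le, by linarith [hx.2]⟩ ⟨hy.1.le, by linarith [hy.2]⟩ (by linarith)
  have himage := integral_image_eq_integral_abs_deriv_smul measurableSet_Ioo
    (fun A _ => (((Real.hasDerivAt_cos A).const_sub 1).congr_deriv (neg_neg _)).hasDerivWithinAt)
    hinj K
  rw [image_one_sub_cos] at himage
  rw [himage]
  have hK_eq : ∀ A ∈ Ioo 0 (π / 3), |Real.sin A| • K (1 - Real.cos A) = Tpoly(A) := by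
    intro A hA
    rw [abs_of_nonneg (Real.sin_nonneg_of_nonneg_of_le_pi hA.1.le (by linarith [hA.2])),
      smul_eq_mul, hK]
    simp only
    rw [inner_integral_R1t hA, sin_mul_kA]
  rw [setIntegral_congr_fun measurableSet_Ioo hK_eq, ← integral_Ioc_eq_integral_Ioo,
    ← intervalIntegral.integral_of_le (by linarith), integral_Tpoly]
  ring

end Psi


/-! ## The value of the complete star -/

section StarValue

/-- `vol Far = Ψ = 1/4 − π²/18 + √3π/12` (as `ofReal`). [folklore] -/
theorem volume_far_value :
    volume {w : (ℝ × ℝ) × (ℝ × ℝ) |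
        w.1.1 ^ 2 + w.1.2 ^ 2 < 1 ∧ (1 - w.1.1) ^ 2 + (0 - w.1.2) ^ 2 < 1 ∧
        w.2.1 ^ 2 + w.2.2 ^ 2 < 1 ∧ (1 - w.2.1) ^ 2 + (0 - w.2.2) ^ 2 < 1 ∧
        1 ≤ (w.1.1 - w.2.1) ^ 2 + (w.1.2 - w.2.2) ^ 2} =
      ENNReal.ofReal (1 / 4 - π ^ 2 / 18 + Real.sqrt 3 * π / 12) := by
  rw [volume_far_eq_far2, volume_far2_eq_lintegral, ← integral_sq_posPart]
  symm
  refine ofReal_integral_eq_lintegral_ofReal ?_ (ae_of_all _ fun z => sq_nonneg _)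
  refine Measure.integrableOn_of_bounded (M := 9) (by rw [volume_unitSq]; exact ENNReal.one_ne_top)
    ?_ (ae_of_all _ fun z => ?_)
  · have h1 : Measurable fun z : ℝ × ℝ => Real.sqrt (1 - max (z.1 ^ 2) ((1 - z.1) ^ 2)) :=
      continuous_mS.measurable.comp measurable_fst
    have h2 : Measurable fun z : ℝ × ℝ => Real.sqrt (1 - max (z.2 ^ 2) ((1 - z.2) ^ 2)) :=
      continuous_mS.measurable.comp measurable_snd
    have h3 : Measurable fun z : ℝ × ℝ => Real.sqrt (1 - (z.1 - z.2) ^ 2) :=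
      (Real.continuous_sqrt.comp (by fun_prop)).measurable
    exact ((((h1.add h2).sub h3).max measurable_const).pow_const 2).aestronglyMeasurable
  · rw [Real.norm_eq_abs, abs_of_nonneg (sq_nonneg _)]
    have h1 := mS_le_one z.1; have h2 := mS_le_one z.2
    have h1' := Real.sqrt_nonneg (1 - max (z.1 ^ 2) ((1 - z.1) ^ 2))
    have h2' := Real.sqrt_nonneg (1 - max (z.2 ^ 2) ((1 - z.2) ^ 2))
    have h3' := Real.sqrt_nonneg (1 - (z.1 - z.2) ^ 2)
    have hM : max (Real.sqrt (1 - max (z.1 ^ 2) ((1 - z.1) ^ 2)) +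
        Real.sqrt (1 - max (z.2 ^ 2) ((1 - z.2) ^ 2)) - Real.sqrt (1 - (z.1 - z.2) ^ 2)) 0 ≤ 3 :=
      max_le (by linarith) (by norm_num)
    have hM0 : 0 ≤ max (Real.sqrt (1 - max (z.1 ^ 2) ((1 - z.1) ^ 2)) +
        Real.sqrt (1 - max (z.2 ^ 2) ((1 - z.2) ^ 2)) - Real.sqrt (1 - (z.1 - z.2) ^ 2)) 0 :=
      le_max_right _ _
    nlinarith

/-- **Volume of the complete star diagram** in product coordinates:
`V(K₄) = π³ − (3√3/2)π² + π`. [folklore] -/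
theorem volume_starProd_toReal :
    (volume {x : (ℝ × ℝ) × (ℝ × ℝ) × (ℝ × ℝ) | x.1.1 ^ 2 + x.1.2 ^ 2 < 1 ∧
      x.2.1.1 ^ 2 + x.2.1.2 ^ 2 < 1 ∧ x.2.2.1 ^ 2 + x.2.2.2 ^ 2 < 1 ∧
      (x.1.1 - x.2.1.1) ^ 2 + (x.1.2 - x.2.1.2) ^ 2 < 1 ∧
      (x.1.1 - x.2.2.1) ^ 2 + (x.1.2 - x.2.2.2) ^ 2 < 1 ∧
      (x.2.1.1 - x.2.2.1) ^ 2 + (x.2.1.2 - x.2.2.2) ^ 2 < 1}).toReal =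
      π ^ 3 - 3 * Real.sqrt 3 / 2 * π ^ 2 + π := by
  rw [volume_starProd, volume_std_eq, volume_far_value]
  have h3 : Real.sqrt 3 < 2 := by
    rw [show (2:ℝ) = Real.sqrt 4 by rw [show (4:ℝ) = 2 ^ 2 by norm_num, Real.sqrt_sq (by norm_num)]]
    exact Real.sqrt_lt_sqrt (by norm_num) (by norm_num)
  have hπ3 : 3 < π := Real.pi_gt_three
  have hA1 : 0 ≤ 2 * π / 3 - Real.sqrt 3 / 2 := by linarith
  have hΨ : 0 ≤ 1 / 4 - π ^ 2 / 18 + Real.sqrt 3 * π / 12 := by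
    have hp1 : (3.14 : ℝ) < π := Real.pi_gt_d2
    have hp2 : π < 3.15 := Real.pi_lt_d2
    have hs3 : (1.732 : ℝ) < Real.sqrt 3 := (Real.lt_sqrt (by norm_num)).2 (by norm_num)
    have e1 : 0 < (Real.sqrt 3 - 1.732) * (π - 3.14) := mul_pos (by linarith) (by linarith)
    have e2 : 0 < (3.15 - π) * π := mul_pos (by linarith) Real.pi_pos
    nlinarith [e1, e2]
  have hle : 1 / 4 - π ^ 2 / 18 + Real.sqrt 3 * π / 12 ≤
      (2 * π / 3 - Real.sqrt 3 / 2) * (2 * π / 3 - Real.sqrt 3 / 2) := by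
    nlinarith [Real.pi_lt_four, Real.sqrt_nonneg 3, Real.sq_sqrt (show (0:ℝ) ≤ 3 by norm_num)]
  rw [← ENNReal.ofReal_mul hA1, ← ENNReal.ofReal_sub _ hΨ, ← ENNReal.ofReal_mul (by positivity),
    ENNReal.toReal_ofReal (mul_nonneg (by positivity) (by linarith))]
  have hs : Real.sqrt 3 ^ 2 = 3 := Real.sq_sqrt (by norm_num)
  linear_combination (π / 2) * hs

end StarValue


/-! ## From `Fin 6 → ℝ` to product coordinates; the discharge -/

section Transfer

/-- The coordinate map `((a,b),(c,d),(e,f)) ↦ ![a,b,c,d,e,f]` is measurable. [folklore] -/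
theorem measurable_toFin6 : Measurable fun x : (ℝ × ℝ) × (ℝ × ℝ) × (ℝ × ℝ) =>
    (![x.1.1, x.1.2, x.2.1.1, x.2.1.2, x.2.2.1, x.2.2.2] : Fin 6 → ℝ) := by
  refine measurable_pi_lambda _ (fun i => ?_)
  fin_cases i
  · exact measurable_fst.fst
  · exact measurable_fst.snd
  · exact measurable_snd.fst.fst
  · exact measurable_snd.fst.snd
  · exact measurable_snd.snd.fst
  · exact measurable_snd.snd.snd

/-- The coordinate map carries the product Lebesgue measure of `(ℝ × ℝ)³` to that of `Fin 6 → ℝ`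
(`Measure.pi_eq`: both give a box the product of its sides). [folklore] -/
theorem measurePreserving_toFin6 : MeasurePreserving (fun x : (ℝ × ℝ) × (ℝ × ℝ) × (ℝ × ℝ) =>
    (![x.1.1, x.1.2, x.2.1.1, x.2.1.2, x.2.2.1, x.2.2.2] : Fin 6 → ℝ)) volume volume := by
  refine ⟨measurable_toFin6, ?_⟩
  symm
  rw [volume_pi]
  refine Measure.pi_eq (fun s hs => ?_)
  rw [Measure.map_apply measurable_toFin6 (MeasurableSet.univ_pi hs)]
  have : (fun x : (ℝ × ℝ) × (ℝ × ℝ) × (ℝ × ℝ) =>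
      (![x.1.1, x.1.2, x.2.1.1, x.2.1.2, x.2.2.1, x.2.2.2] : Fin 6 → ℝ)) ⁻¹' (Set.pi univ s) =
      (s 0 ×ˢ s 1) ×ˢ ((s 2 ×ˢ s 3) ×ˢ (s 4 ×ˢ s 5)) := by
    ext x
    simp only [mem_preimage, mem_univ_pi, mem_prod]
    constructor
    · intro h; exact ⟨⟨h 0, h 1⟩, ⟨h 2, h 3⟩, h 4, h 5⟩
    · rintro ⟨⟨h0, h1⟩, ⟨h2, h3⟩, h4, h5⟩ i
      fin_cases i <;> assumption
  rw [this, Measure.volume_eq_prod, Measure.prod_prod, Measure.volume_eq_prod, Measure.prod_prod,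
    Measure.volume_eq_prod, Measure.prod_prod, Measure.volume_eq_prod, Measure.prod_prod,
    Measure.prod_prod, Fin.prod_univ_six]
  ring

/-- The other coordinate order `((c,d),(a,b),(e,f)) ↦ ![a,b,c,d,e,f]` (pivot `r₃` first) is
measurable. [folklore] -/
theorem measurable_toFin6' : Measurable fun x : (ℝ × ℝ) × (ℝ × ℝ) × (ℝ × ℝ) =>
    (![x.2.1.1, x.2.1.2, x.1.1, x.1.2, x.2.2.1, x.2.2.2] : Fin 6 → ℝ) := by
  refine measurable_pi_lambda _ (fun i => ?_)
  fin_cases i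
  · exact measurable_snd.fst.fst
  · exact measurable_snd.fst.snd
  · exact measurable_fst.fst
  · exact measurable_fst.snd
  · exact measurable_snd.snd.fst
  · exact measurable_snd.snd.snd

/-- … and is likewise measure preserving. [folklore] -/
theorem measurePreserving_toFin6' : MeasurePreserving (fun x : (ℝ × ℝ) × (ℝ × ℝ) × (ℝ × ℝ) =>
    (![x.2.1.1, x.2.1.2, x.1.1, x.1.2, x.2.2.1, x.2.2.2] : Fin 6 → ℝ)) volume volume := by
  refine ⟨measurable_toFin6', ?_⟩
  symm
  rw [volume_pi]
  refine Measure.pi_eq (fun s hs => ?_)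
  rw [Measure.map_apply measurable_toFin6' (MeasurableSet.univ_pi hs)]
  have : (fun x : (ℝ × ℝ) × (ℝ × ℝ) × (ℝ × ℝ) =>
      (![x.2.1.1, x.2.1.2, x.1.1, x.1.2, x.2.2.1, x.2.2.2] : Fin 6 → ℝ)) ⁻¹' (Set.pi univ s) =
      (s 2 ×ˢ s 3) ×ˢ ((s 0 ×ˢ s 1) ×ˢ (s 4 ×ˢ s 5)) := by
    ext x
    simp only [mem_preimage, mem_univ_pi, mem_prod]
    constructor
    · intro h; exact ⟨⟨h 2, h 3⟩, ⟨h 0, h 1⟩, h 4, h 5⟩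
    · rintro ⟨⟨h2, h3⟩, ⟨h0, h1⟩, h4, h5⟩ i
      fin_cases i <;> assumption
  rw [this, Measure.volume_eq_prod, Measure.prod_prod, Measure.volume_eq_prod, Measure.prod_prod,
    Measure.volume_eq_prod, Measure.prod_prod, Measure.volume_eq_prod, Measure.prod_prod,
    Measure.prod_prod, Fin.prod_univ_six]
  ring

/-- `hardDiscRing` is measurable. [folklore] -/
theorem measurableSet_hardDiscRing : MeasurableSet hardDiscRing := by
  simp only [hardDiscRing, setOf_and]
  refine MeasurableSet.inter ?_ (MeasurableSet.inter ?_ (MeasurableSet.inter ?_ ?_)) <;>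
    exact measurableSet_lt (by fun_prop) (by fun_prop)

/-- `hardDiscDiamond` is measurable. [folklore] -/
theorem measurableSet_hardDiscDiamond : MeasurableSet hardDiscDiamond := by
  simp only [hardDiscDiamond, setOf_and]
  refine MeasurableSet.inter ?_ (MeasurableSet.inter ?_ (MeasurableSet.inter ?_
    (MeasurableSet.inter ?_ ?_))) <;>
    exact measurableSet_lt (by fun_prop) (by fun_prop)

/-- `hardDiscStar` is measurable. [folklore] -/
theorem measurableSet_hardDiscStar : MeasurableSet hardDiscStar := by
  simp only [hardDiscStar, setOf_and]
  refine MeasurableSet.inter ?_ (MeasurableSet.inter ?_ (MeasurableSet.inter ?_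
    (MeasurableSet.inter ?_ (MeasurableSet.inter ?_ ?_)))) <;>
    exact measurableSet_lt (by fun_prop) (by fun_prop)

/-- **Volume of the ring Mayer diagram of hard discs**: `V(C₄) = π³ − 16π/3`.
[folklore] -/
theorem volume_hardDiscRing_toReal : (volume hardDiscRing).toReal = π ^ 3 - 16 * π / 3 := by
  have hpre : (fun x : (ℝ × ℝ) × (ℝ × ℝ) × (ℝ × ℝ) =>
      (![x.2.1.1, x.2.1.2, x.1.1, x.1.2, x.2.2.1, x.2.2.2] : Fin 6 → ℝ)) ⁻¹' hardDiscRing =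
      {x : (ℝ × ℝ) × (ℝ × ℝ) × (ℝ × ℝ) |
        x.2.1.1 ^ 2 + x.2.1.2 ^ 2 < 1 ∧ (x.2.1.1 - x.1.1) ^ 2 + (x.2.1.2 - x.1.2) ^ 2 < 1 ∧
        (x.1.1 - x.2.2.1) ^ 2 + (x.1.2 - x.2.2.2) ^ 2 < 1 ∧ x.2.2.1 ^ 2 + x.2.2.2 ^ 2 < 1} := by
    ext x
    simp [hardDiscRing]
  rw [← measurePreserving_toFin6'.measure_preimage measurableSet_hardDiscRing.nullMeasurableSet,
    hpre, volume_ringProd, ← ENNReal.ofReal_mul (by positivity), ENNReal.toReal_ofReal]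
  · ring
  · nlinarith [Real.pi_gt_three, Real.pi_pos]

/-- **Volume of the diamond Mayer diagram of hard discs**: `V(◇) = π³ − √3π² − 5π/6`.
[folklore] -/
theorem volume_hardDiscDiamond_toReal :
    (volume hardDiscDiamond).toReal = π ^ 3 - Real.sqrt 3 * π ^ 2 - 5 * π / 6 := by
  have hpre : (fun x : (ℝ × ℝ) × (ℝ × ℝ) × (ℝ × ℝ) =>
      (![x.2.1.1, x.2.1.2, x.1.1, x.1.2, x.2.2.1, x.2.2.2] : Fin 6 → ℝ)) ⁻¹' hardDiscDiamond =
      {x : (ℝ × ℝ) × (ℝ × ℝ) × (ℝ × ℝ) |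
        x.2.1.1 ^ 2 + x.2.1.2 ^ 2 < 1 ∧ (x.2.1.1 - x.1.1) ^ 2 + (x.2.1.2 - x.1.2) ^ 2 < 1 ∧
        (x.1.1 - x.2.2.1) ^ 2 + (x.1.2 - x.2.2.2) ^ 2 < 1 ∧ x.2.2.1 ^ 2 + x.2.2.2 ^ 2 < 1 ∧
        x.1.1 ^ 2 + x.1.2 ^ 2 < 1} := by
    ext x
    simp [hardDiscDiamond]
  have h3 : Real.sqrt 3 < 2 := by
    rw [show (2:ℝ) = Real.sqrt 4 by rw [show (4:ℝ) = 2 ^ 2 by norm_num, Real.sqrt_sq (by norm_num)]]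
    exact Real.sqrt_lt_sqrt (by norm_num) (by norm_num)
  rw [← measurePreserving_toFin6'.measure_preimage measurableSet_hardDiscDiamond.nullMeasurableSet,
    hpre, volume_diamondProd, ← ENNReal.ofReal_mul (by positivity), ENNReal.toReal_ofReal]
  · ring
  · nlinarith [Real.pi_gt_three, Real.pi_pos, mul_pos Real.pi_pos (sub_pos.2 h3)]

/-- **Volume of the complete star Mayer diagram of hard discs** (Rowlinson 1964, Hemmer 1964):
`V(K₄) = π³ − (3√3/2)π² + π`. [folklore] -/
theorem volume_hardDiscStar_toReal :
    (volume hardDiscStar).toReal = π ^ 3 - 3 * Real.sqrt 3 / 2 * π ^ 2 + π := by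
  have hpre : (fun x : (ℝ × ℝ) × (ℝ × ℝ) × (ℝ × ℝ) =>
      (![x.1.1, x.1.2, x.2.1.1, x.2.1.2, x.2.2.1, x.2.2.2] : Fin 6 → ℝ)) ⁻¹' hardDiscStar =
      {x : (ℝ × ℝ) × (ℝ × ℝ) × (ℝ × ℝ) | x.1.1 ^ 2 + x.1.2 ^ 2 < 1 ∧
        x.2.1.1 ^ 2 + x.2.1.2 ^ 2 < 1 ∧ x.2.2.1 ^ 2 + x.2.2.2 ^ 2 < 1 ∧
        (x.1.1 - x.2.1.1) ^ 2 + (x.1.2 - x.2.1.2) ^ 2 < 1 ∧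
        (x.1.1 - x.2.2.1) ^ 2 + (x.1.2 - x.2.2.2) ^ 2 < 1 ∧
        (x.2.1.1 - x.2.2.1) ^ 2 + (x.2.1.2 - x.2.2.2) ^ 2 < 1} := by
    ext x
    simp [hardDiscStar]
  rw [← measurePreserving_toFin6.measure_preimage measurableSet_hardDiscStar.nullMeasurableSet,
    hpre, volume_starProd_toReal]

end Transfer


end HardDiscB4Volume


open HardDiscB4Volume in
/-- **Fourth virial coefficient of hard discs** — discharge of the named fact
`ClisbyMcCoy2004_B4_hardDiscs`: with `V(C₄) = π³ − 16π/3`, `V(◇) = π³ − √3π² − 5π/6`,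
`V(K₄) = π³ − (3√3/2)π² + π` one gets
`(−(3/8)V(C₄) + (3/4)V(◇) − (1/8)V(K₄))/(π/2)³ = 2 − 9√3/(2π) + 10/π²`, i.e.
`B₄/B₂³ = 2 − 9√3/(2π) + 10/π²` (Rowlinson 1964, Hemmer 1964).
[cite: ClisbyMccoy2004, §1 (display B₄/B₂³ for D = 2 and the Mayer expansion of B₄)] -/
theorem ClisbyMcCoy2004_B4_hardDiscs_holds : ClisbyMcCoy2004_B4_hardDiscs := by
  unfold ClisbyMcCoy2004_B4_hardDiscs
  rw [volume_hardDiscRing_toReal, volume_hardDiscDiamond_toReal, volume_hardDiscStar_toReal]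
  have hπ : π ≠ 0 := Real.pi_ne_zero
  field_simp
  ring


end Literature.MathematicalPhysics.StatisticalMechanics

end
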